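import Mathlib.LinearAlgebra.Matrix.Charpoly.Coeff
import Mathlib.LinearAlgebra.Matrix.GeneralLinearGroup.Defs
import Mathlib.Algebra.CharP.Lemmas
import Mathlib.LinearAlgebra.Matrix.CharP
import Mathlib.LinearAlgebra.Matrix.ToLin
import Mathlib.LinearAlgebra.FiniteDimensional.Lemmas
import Mathlib.GroupTheory.Perm.Cycle.Type
import Mathlib.GroupTheory.Index
import Mathlib.GroupTheory.SpecificGroups.Cyclic
import Mathlib.GroupTheory.GroupAction.ConjAct
import Mathlib.GroupTheory.GroupAction.Quotient
import Mathlib.Algebra.Group.Subgroup.Pointwise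
import Mathlib.Algebra.Group.Subgroup.Finite
import Mathlib.Algebra.BigOperators.Ring.Finset
import Mathlib.Algebra.Order.BigOperators.Group.Finset
import Mathlib.Algebra.Order.Archimedean.Real.Basic
import Mathlib.Tactic.Group
import Mathlib.Tactic.Ring
import Mathlib.Tactic.IntervalCases
import Mathlib.Tactic.Linarith
import Mathlib.Tactic.Positivity
import Mathlib.Tactic.FieldSimp
import Mathlib.Tactic.LinearCombination
import Mathlib.Tactic.Module
import Literature.NumberTheory.GaloisRepresentations.DeligneSerreGL2Subgroups
import HarnessLib

/-!
# Deligne–Serre 1974, Prop. 7.2 — proof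

This file discharges the named fact `Literature.NumberTheory.GaloisRepresentations.DeligneSerre1974.prop72`
(`Literature/NumberTheory/GaloisRepresentations/DeligneSerreGL2Subgroups.lean`):

> **Prop. 7.2.** Let `η < 1/2` and `M ≥ 0`. There is `A = A(η, M)` such that for every prime `ℓ`
> and every semisimple subgroup `G ⊆ GL₂(𝔽_ℓ)` with property `C(η, M)` one has `|G| ≤ A`.

as `Literature.NumberTheory.GaloisRepresentations.DeligneSerre1974.prop72_holds`, with the explicit constant
`A = 16 + b₁⁴ + b₁ + b₂ + b₃`, `b₁ = ⌊2M/(1-η)⌋`, `b₂ = ⌊4M/(1-2η)⌋`, `b₃ = ⌊120M/(1-η)⌋`.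

## The printed proof and the proof given here

Deligne–Serre (pp. 523–524) run through Dickson's list (Serre 1972, §2, Prop. 15–16): a
semisimple `G` either (a) contains `SL₂(𝔽_ℓ)`, or (b) lies in a Cartan subgroup, or (c) lies in
the normaliser of a Cartan subgroup `T` but not in `T`, or (d) has image `𝔄₄, 𝔖₄, 𝔄₅` in
`PGL₂(𝔽_ℓ)`; in each case the number of elements of `G` with a given characteristic polynomial
is small compared with `|G|`, which bounds `|G|` under `C(η, M)` (case (c) is where `η < 1/2`
is needed: `G ∩ T` has index `2` and satisfies `C(2η, M)`). Mathlib has no Dickson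
classification, so we prove exactly the four estimates that the argument uses, as follows
(`S(τ, δ) = {g ∈ G | tr g = τ, det g = δ}`; `det(1 - gT) = 1 - τT + δT²` determines `(τ, δ)`):

* **Step 0** (`exists_fibres_of_hasPropertyC`): `C(η, M)` gives at most `M` pairs `(τ, δ)` whose
  fibres `S(τ, δ)` carry `≥ (1 - η)|G|` elements.
* **Case (a), `ℓ ∣ |G|`** (`mul_card_filter_trace_det_le_of_dvd`): `ℓ |S(τ, δ)| ≤ 2|G|`, whence
  `ℓ (1 - η) ≤ 2M` and `|G| ≤ |GL₂(𝔽_ℓ)| ≤ ℓ⁴`. Proof: Cauchy gives `g = 1 + N ∈ G` of order `ℓ`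
  (`N ≠ 0 = N²`); semisimplicity gives `h ∈ G` moving the line of `N`, i.e. `tr(hN) ≠ 0`
  (`exists_trace_mul_ne_zero`); the stabiliser `B = {k | tr(kN) = 0}` of that line then has
  `≥ ℓ + 1` cosets (`B`, `gˣ h B`), and outside `B` the trace is injective on cosets of `⟨g⟩`.
* **Cases (b)–(d), `ℓ ∤ |G|`, `ℓ` odd.** For non-central `x ∈ G` the centraliser `C_G(x)` is
  `G ∩ 𝔽_ℓ[x]` (`TwoByTwo.exists_eq_smul_one_add_smul_of_commute`), `x` is regular semisimple
  (`TwoByTwo.disc_ne_zero_of_pow_eq_one`), at most two elements of `𝔽_ℓ[x]` have a given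
  `(τ, δ)` (`TwoByTwo.eq_or_eq_or_eq_of_trace_eq_of_det_eq`), commutation is transitive off the
  centre (`centralizer_eq_of_mem`) and `|N_G(C_G(x))| ≤ 2 |C_G(x)|`
  (`card_normalizer_centralizer_le`). The purely group-theoretic
  `Counting.card_le_sixty_mul_card_center` (count `G ∖ Z(G)` along the conjugacy classes of the
  maximal tori `C_G(x)`: each class has `≥ |G|/4` elements, so there are at most three, and the
  equation `1 - 1/n = Σᵢ (1 - 1/aᵢ)/eᵢ` has no solution with `n = [G : Z(G)] > 60` unless some
  torus has index `≤ 2` — the arithmetic is `Counting.le_sixty_of_one/two/three`) replaces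
  Dickson's list: either (b) `G` is abelian (`|S(τ, δ)| ≤ 2`), or (c) some torus
  `A = C_G(x)` has index `≤ 2` (`|S(τ, δ) ∩ A| ≤ 2`, the parts outside `A` are disjoint, so
  `(1 - 2η)|A| ≤ 2M`), or (d) `[G : Z(G)] ≤ 60` and `|S(τ, δ)| ≤ 2 [G : Z(G)] ≤ 120`
  (`card_filter_trace_det_le_index_center`: `Z(G)` consists of scalars `c` with `c² = 1`).
* `ℓ = 2`: `|G| ≤ 16`.

## References

* P. Deligne, J.-P. Serre, *Formes modulaires de poids 1*, Ann. Sci. ÉNS (4) 7 (1974), 507–530,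
  §7, Prop. 7.2 and its proof, pp. 523–524 (`DeligneSerreASENS1974`).
* J.-P. Serre, *Propriétés galoisiennes des points d'ordre fini des courbes elliptiques*, Invent.
  Math. 15 (1972), 259–331, §2.4–2.6 (Dickson's classification; the orbit count of §2.5 is the
  model for `Counting.card_le_sixty_mul_card_center`).
-/

/-! ## `2 × 2` matrix algebra -/

namespace Literature.NumberTheory.GaloisRepresentations.DeligneSerre1974.TwoByTwo

open Matrix Polynomial

variable {K : Type*} [Field K]

/-- `det(1 - gT) = 1 - tr(g) T + det(g) T²` for a `2 × 2` matrix. [folklore] -/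
lemma charpolyRev_fin_two {R : Type*} [CommRing R] (g : Matrix (Fin 2) (Fin 2) R) :
    g.charpolyRev = 1 - C g.trace * X + C g.det * X ^ 2 := by
  simp [Matrix.charpolyRev, Matrix.det_fin_two, Matrix.trace_fin_two]
  ring

/-- Two `2 × 2` matrices with the same `det(1 - gT)` have the same trace and determinant.
[folklore] -/
lemma trace_eq_and_det_eq_of_charpolyRev_eq {R : Type*} [CommRing R]
    {g h : Matrix (Fin 2) (Fin 2) R} (he : g.charpolyRev = h.charpolyRev) :
    g.trace = h.trace ∧ g.det = h.det := by
  have h1 := congrArg (fun p : R[X] ↦ p.coeff 1) he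
  have h2 := congrArg (fun p : R[X] ↦ p.coeff 2) he
  simp only [charpolyRev_fin_two, coeff_add, coeff_sub, coeff_one, coeff_C_mul_X,
    coeff_C_mul_X_pow] at h1 h2
  norm_num at h1 h2
  exact ⟨h1, h2⟩

/-- Cayley–Hamilton for `2 × 2` matrices. [folklore] -/
lemma mul_self_eq (g : Matrix (Fin 2) (Fin 2) K) :
    g * g = g.trace • g - g.det • (1 : Matrix (Fin 2) (Fin 2) K) := by
  ext i j
  fin_cases i <;> fin_cases j <;>
    simp [Matrix.mul_apply, Fin.sum_univ_two, trace_fin_two, det_fin_two] <;> ring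

/-- Polarised Cayley–Hamilton for `2 × 2` matrices. [folklore] -/
lemma mul_add_mul_eq (a b : Matrix (Fin 2) (Fin 2) K) :
    a * b + b * a = a.trace • b + b.trace • a +
      ((a * b).trace - a.trace * b.trace) • (1 : Matrix (Fin 2) (Fin 2) K) := by
  ext i j
  fin_cases i <;> fin_cases j <;>
    simp [Matrix.mul_apply, Fin.sum_univ_two, trace_fin_two] <;> ring

/-- Rank-one identity: if `det N = 0` then `N h N = tr(hN) N`. [folklore] -/
lemma mul_mul_self_of_det_eq_zero (N h : Matrix (Fin 2) (Fin 2) K) (hN : N.det = 0) :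
    N * h * N = (h * N).trace • N := by
  rw [det_fin_two] at hN
  ext i j
  fin_cases i <;> fin_cases j <;>
    simp [Matrix.mul_apply, Fin.sum_univ_two, trace_fin_two]
  · linear_combination (-(h 1 1)) * hN
  · linear_combination (h 0 1) * hN
  · linear_combination (h 1 0) * hN
  · linear_combination (-(h 0 0)) * hN

/-- `tr(c + d g) = 2c + d tr g`. [folklore] -/
lemma trace_smul_one_add_smul (c d : K) (g : Matrix (Fin 2) (Fin 2) K) :
    (c • (1 : Matrix (Fin 2) (Fin 2) K) + d • g).trace = 2 * c + d * g.trace := by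
  simp [trace_fin_two]; ring

/-- `det(c + d g) = c² + c d tr g + d² det g` (the norm form of `K[g]`). [folklore] -/
lemma det_smul_one_add_smul (c d : K) (g : Matrix (Fin 2) (Fin 2) K) :
    (c • (1 : Matrix (Fin 2) (Fin 2) K) + d • g).det = c ^ 2 + c * d * g.trace + d ^ 2 * g.det := by
  simp [det_fin_two, trace_fin_two]; ring


/-- The centraliser of a non-scalar `2 × 2` matrix `g` is `K[g] = K·1 + K·g`. [folklore] -/
lemma exists_eq_smul_one_add_smul_of_commute {g h : Matrix (Fin 2) (Fin 2) K}
    (hns : ∀ c : K, g ≠ c • 1)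
    (hc : g * h = h * g) : ∃ a b : K, h = a • (1 : Matrix (Fin 2) (Fin 2) K) + b • g := by
  have e := fun i j ↦ congrFun (congrFun hc i) j
  have e00 := e 0 0
  have e01 := e 0 1
  have e10 := e 1 0
  have e11 := e 1 1
  simp only [Matrix.mul_apply, Fin.sum_univ_two] at e00 e01 e10 e11
  -- it suffices to produce `a, b` with the four entry identities
  suffices H : ∃ a b : K, h 0 0 = a + b * g 0 0 ∧ h 0 1 = b * g 0 1 ∧ h 1 0 = b * g 1 0 ∧
      h 1 1 = a + b * g 1 1 by
    obtain ⟨a, b, h00, h01, h10, h11⟩ := H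
    refine ⟨a, b, ?_⟩
    ext i j
    fin_cases i <;> fin_cases j <;> simp [h00, h01, h10, h11]
  by_cases hq : g 0 1 = 0
  · by_cases hr : g 1 0 = 0
    · -- diagonal, non-scalar: `g 0 0 ≠ g 1 1`
      have hps : g 0 0 - g 1 1 ≠ 0 := by
        intro hps
        apply hns (g 0 0)
        ext i j
        fin_cases i <;> fin_cases j <;> simp [hq, hr]
        linear_combination -hps
      rw [hq] at e01
      rw [hr] at e10
      have hy : h 0 1 = 0 := by
        have : (g 0 0 - g 1 1) * h 0 1 = 0 := by linear_combination e01
        simpa [hps] using this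
      have hz : h 1 0 = 0 := by
        have : (g 0 0 - g 1 1) * h 1 0 = 0 := by linear_combination -e10
        simpa [hps] using this
      refine ⟨h 0 0 - (h 0 0 - h 1 1) / (g 0 0 - g 1 1) * g 0 0,
        (h 0 0 - h 1 1) / (g 0 0 - g 1 1), by ring, by rw [hy, hq, mul_zero],
        by rw [hz, hr, mul_zero], ?_⟩
      field_simp
      ring
    · refine ⟨h 0 0 - h 1 0 / g 1 0 * g 0 0, h 1 0 / g 1 0, by ring, ?_, ?_, ?_⟩
      · field_simp
        linear_combination e11
      · field_simp
      · field_simp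
        linear_combination -e10
  · refine ⟨h 0 0 - h 0 1 / g 0 1 * g 0 0, h 0 1 / g 0 1, by ring, ?_, ?_, ?_⟩
    · field_simp
    · field_simp
      linear_combination e00
    · field_simp
      linear_combination e01

/-- A non-scalar element `h = a • 1 + b • g` (`b ≠ 0`) of `K[g]` generates it: `g ∈ K[h]`.
[folklore] -/
lemma exists_eq_smul_one_add_smul_symm {g h : Matrix (Fin 2) (Fin 2) K} {a b : K}
    (hh : h = a • (1 : Matrix (Fin 2) (Fin 2) K) + b • g)
    (hb : b ≠ 0) : ∃ a' b' : K, g = a' • (1 : Matrix (Fin 2) (Fin 2) K) + b' • h := by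
  refine ⟨-a / b, 1 / b, ?_⟩
  rw [hh, smul_add, smul_smul, smul_smul, ← add_assoc, ← add_smul, one_div, inv_mul_cancel₀ hb,
    one_smul]
  have : -a / b + b⁻¹ * a = 0 := by
    field_simp
    ring
  rw [this, zero_smul, zero_add]

/-- In `K[g]`, `g` with non-zero discriminant, `char K ≠ 2`: at most two elements
have a given trace and determinant (three such elements cannot be pairwise distinct). [folklore] -/
lemma eq_or_eq_or_eq_of_trace_eq_of_det_eq {g : Matrix (Fin 2) (Fin 2) K} (h2 : (2 : K) ≠ 0)
    (hdisc : g.trace ^ 2 - 4 * g.det ≠ 0) {a₁ b₁ a₂ b₂ a₃ b₃ : K}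
    (ht₁₂ : (a₁ • (1 : Matrix (Fin 2) (Fin 2) K) + b₁ • g).trace =
      (a₂ • (1 : Matrix (Fin 2) (Fin 2) K) + b₂ • g).trace)
    (ht₁₃ : (a₁ • (1 : Matrix (Fin 2) (Fin 2) K) + b₁ • g).trace =
      (a₃ • (1 : Matrix (Fin 2) (Fin 2) K) + b₃ • g).trace)
    (hd₁₂ : (a₁ • (1 : Matrix (Fin 2) (Fin 2) K) + b₁ • g).det =
      (a₂ • (1 : Matrix (Fin 2) (Fin 2) K) + b₂ • g).det)
    (hd₁₃ : (a₁ • (1 : Matrix (Fin 2) (Fin 2) K) + b₁ • g).det =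
      (a₃ • (1 : Matrix (Fin 2) (Fin 2) K) + b₃ • g).det) :
    a₁ • (1 : Matrix (Fin 2) (Fin 2) K) + b₁ • g =
      a₂ • (1 : Matrix (Fin 2) (Fin 2) K) + b₂ • g ∨
      a₁ • (1 : Matrix (Fin 2) (Fin 2) K) + b₁ • g =
        a₃ • (1 : Matrix (Fin 2) (Fin 2) K) + b₃ • g ∨
      a₂ • (1 : Matrix (Fin 2) (Fin 2) K) + b₂ • g =
        a₃ • (1 : Matrix (Fin 2) (Fin 2) K) + b₃ • g := by
  simp only [trace_smul_one_add_smul, det_smul_one_add_smul] at ht₁₂ ht₁₃ hd₁₂ hd₁₃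
  set t := g.trace
  set d := g.det
  -- `bᵢ² (4d - t²)` is independent of `i`
  have k₁₂ : (b₁ ^ 2 - b₂ ^ 2) * (t ^ 2 - 4 * d) = 0 := by
    linear_combination (2 * a₁ + b₁ * t + 2 * a₂ + b₂ * t) * ht₁₂ - 4 * hd₁₂
  have k₁₃ : (b₁ ^ 2 - b₃ ^ 2) * (t ^ 2 - 4 * d) = 0 := by
    linear_combination (2 * a₁ + b₁ * t + 2 * a₃ + b₃ * t) * ht₁₃ - 4 * hd₁₃
  have s₁₂ : (b₁ - b₂) * (b₁ + b₂) = 0 := by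
    have := (mul_eq_zero.mp k₁₂).resolve_right hdisc
    linear_combination this
  have s₁₃ : (b₁ - b₃) * (b₁ + b₃) = 0 := by
    have := (mul_eq_zero.mp k₁₃).resolve_right hdisc
    linear_combination this
  -- from `bᵢ = bⱼ` the traces give `aᵢ = aⱼ`
  have conclude : ∀ {a b a' b' : K}, 2 * a + b * t = 2 * a' + b' * t → b = b' →
      a • (1 : Matrix (Fin 2) (Fin 2) K) + b • g =
        a' • (1 : Matrix (Fin 2) (Fin 2) K) + b' • g := by
    intro a b a' b' ht hb
    subst hb
    have ha : a = a' := by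
      have : (2 : K) * (a - a') = 0 := by linear_combination ht
      simpa [sub_eq_zero, h2] using this
    rw [ha]
  rcases mul_eq_zero.mp s₁₂ with h | h
  · exact Or.inl (conclude ht₁₂ (by linear_combination h))
  rcases mul_eq_zero.mp s₁₃ with h' | h'
  · exact Or.inr (Or.inl (conclude ht₁₃ (by linear_combination h')))
  refine Or.inr (Or.inr (conclude (by linear_combination ht₁₃ - ht₁₂) ?_))
  linear_combination h - h'

/-- Binomial formula for `c • 1 + N` with `N² = 0`. [folklore] -/
lemma smul_pow_smul_one_add (c : K) {N : Matrix (Fin 2) (Fin 2) K} (hN : N * N = 0) (k : ℕ) :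
    c • (c • (1 : Matrix (Fin 2) (Fin 2) K) + N) ^ k =
      c ^ (k + 1) • (1 : Matrix (Fin 2) (Fin 2) K) + ((k : K) * c ^ k) • N := by
  induction k with
  | zero => simp
  | succ k ih =>
    rw [pow_succ, ← smul_mul_assoc, ih]
    simp only [add_mul, mul_add, smul_mul_assoc, mul_smul_comm, one_mul, mul_one, hN, smul_zero,
      add_zero, Nat.cast_succ, pow_succ]
    module

/-- A non-scalar invertible `2 × 2` matrix of finite order prime to the (odd) characteristic
has non-zero discriminant `tr² - 4 det` (i.e. is regular semisimple). [folklore] -/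
lemma disc_ne_zero_of_pow_eq_one {g : Matrix (Fin 2) (Fin 2) K} (h2 : (2 : K) ≠ 0)
    (hns : ∀ c : K, g ≠ c • 1)
    (hdet : g.det ≠ 0) {m : ℕ} (hm : (m : K) ≠ 0) (hgm : g ^ m = 1) :
    g.trace ^ 2 - 4 * g.det ≠ 0 := by
  intro hdisc
  set c : K := g.trace / 2 with hc
  set N : Matrix (Fin 2) (Fin 2) K := g - c • (1 : Matrix (Fin 2) (Fin 2) K) with hN
  have hg : g = c • (1 : Matrix (Fin 2) (Fin 2) K) + N := by rw [hN]; abel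
  have htr : g.trace = c + c := by rw [hc]; field_simp; ring
  have hdet' : g.det = c * c := by
    have h4 : (4 : K) * g.det = g.trace ^ 2 := by linear_combination -hdisc
    rw [hc]
    field_simp
    linear_combination h4
  have hNN : N * N = 0 := by
    have h := mul_self_eq g
    rw [hN]
    simp only [sub_mul, mul_sub, smul_mul_assoc, mul_smul_comm, one_mul, mul_one, h]
    rw [hdet', htr]
    module
  have key := smul_pow_smul_one_add c hNN m
  rw [← hg, hgm] at key
  -- `(m c^m) • N = (c - c^(m+1)) • 1`, so `(m c^m) • g` is scalar
  have key' : ((m : K) * c ^ m) • g =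
      (c - c ^ (m + 1) + (m : K) * c ^ m * c) • (1 : Matrix (Fin 2) (Fin 2) K) := by
    rw [hN, smul_sub, smul_smul] at key
    have : ((m : K) * c ^ m) • g =
        c • (1 : Matrix (Fin 2) (Fin 2) K) - c ^ (m + 1) • (1 : Matrix (Fin 2) (Fin 2) K) +
          ((m : K) * c ^ m * c) • (1 : Matrix (Fin 2) (Fin 2) K) := by
      rw [key]; abel
    rw [this]
    module
  by_cases hmc : (m : K) * c ^ m = 0
  · have hc0 : c = 0 := by
      rcases mul_eq_zero.mp hmc with h | h
      · exact absurd h hm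
      · exact pow_eq_zero_iff (n := m) (by rintro rfl; simp at hm) |>.mp h
    apply hdet
    rw [hdet', hc0, mul_zero]
  · apply hns ((c - c ^ (m + 1) + (m : K) * c ^ m * c) / ((m : K) * c ^ m))
    rw [div_eq_inv_mul, ← smul_smul, ← key', smul_smul, inv_mul_cancel₀ hmc, one_smul]

end Literature.NumberTheory.GaloisRepresentations.DeligneSerre1974.TwoByTwo


/-! ## The counting lemma (abstract finite groups) -/

namespace Literature.NumberTheory.GaloisRepresentations.DeligneSerre1974.Counting

open Subgroup MulAction
open scoped Pointwise

variable {G : Type*} [Group G]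

/-- Conjugating a centraliser: `k C(x) k⁻¹ = C(k x k⁻¹)`. [folklore] -/
lemma conjAct_smul_centralizer (k x : G) :
    ConjAct.toConjAct k • centralizer ({x} : Set G) = centralizer {k * x * k⁻¹} := by
  ext y
  rw [mem_pointwise_smul_iff_inv_smul_mem, ← ConjAct.toConjAct_inv, ConjAct.toConjAct_smul,
    mem_centralizer_singleton_iff, mem_centralizer_singleton_iff, inv_inv]
  constructor <;> intro h
  · calc y * (k * x * k⁻¹) = k * (k⁻¹ * y * k * x) * k⁻¹ := by group
      _ = k * (x * (k⁻¹ * y * k)) * k⁻¹ := by rw [h]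
      _ = k * x * k⁻¹ * y := by group
  · calc k⁻¹ * y * k * x = k⁻¹ * (y * (k * x * k⁻¹)) * k := by group
      _ = k⁻¹ * ((k * x * k⁻¹) * y) * k := by rw [h]
      _ = x * (k⁻¹ * y * k) := by group

/-- A conjugate subgroup has the same order. [folklore] -/
lemma nat_card_conjAct_smul (k : ConjAct G) (H : Subgroup G) :
    Nat.card (k • H : Subgroup G) = Nat.card H :=
  (Nat.card_congr (equivSMul k H).toEquiv).symm

/-- Orbit–stabiliser for the conjugation action on subgroups: the number of conjugates of `H`
times `|N(H)|` is `|G|`. [folklore] -/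
lemma nat_card_orbit_mul_card_normalizer (H : Subgroup G) :
    Nat.card (orbit (ConjAct G) H) * Nat.card (normalizer (H : Set G)) = Nat.card G := by
  have h1 : Nat.card (stabilizer (ConjAct G) H) = Nat.card (normalizer (H : Set G)) := by
    refine Nat.card_congr (Equiv.subtypeEquiv ConjAct.ofConjAct.toEquiv fun k ↦ ?_)
    rw [mem_stabilizer_iff, ← conjAct_pointwise_smul_iff]
    rfl
  rw [← h1, ← Nat.card_prod, Nat.card_congr (orbitProdStabilizerEquivGroup (ConjAct G) H)]
  rfl


/-! ### The Diophantine analysis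

The arithmetic data of one conjugacy class of maximal tori in the counting argument is a
quintuple `(n, p, c, a, e)` with `p = c·a` (`a = [T : Z] ≥ 2`, `c` = number of conjugates of
`T`), `n = [G : Z] = e·p` with `e = [N(T) : T] ∈ {1, 2}`, and the torus has index `≥ 3`
(`3a ≤ n`); we carry it as the conjunction
`p = c * a ∧ n = e * p ∧ (e = 1 ∨ e = 2) ∧ 2 ≤ a ∧ 3 * a ≤ n`. -/

section Arith

variable {n p c a e : ℕ}

/-- `2c ≤ p` since `a ≥ 2`. [folklore] -/
lemma two_mul_le_of_tca (h : (p = c * a ∧ n = e * p ∧ (e = 1 ∨ e = 2) ∧ 2 ≤ a ∧ 3 * a ≤ n)) :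
    2 * c ≤ p := by
  obtain ⟨hp, -, -, ha, -⟩ := h
  rw [hp, mul_comm]
  exact Nat.mul_le_mul_left c ha

/-- Degenerate case `c = 0`. [folklore] -/
lemma eq_zero_of_tca (h : (p = c * a ∧ n = e * p ∧ (e = 1 ∨ e = 2) ∧ 2 ≤ a ∧ 3 * a ≤ n))
    (hc : c = 0) : n = 0 := by
  obtain ⟨hp, hn, -, -, -⟩ := h; subst hc; simp [hn, hp]

end Arith


/-- `k ≤ a` and `p = c a` give `k c ≤ p`. [folklore] -/
lemma mul_le_of_eq_mul {p c a k : ℕ} (hp : p = c * a) (hk : k ≤ a) : k * c ≤ p := by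
  rw [hp, mul_comm]
  exact Nat.mul_le_mul_left c hk

variable {n : ℕ}

/-- One class of tori: `n = 1 + c(a-1)` forces `n ≤ 60` (in fact `n ≤ 1`). [folklore] -/
lemma le_sixty_of_one {p c a e : ℕ}
    (h : (p = c * a ∧ n = e * p ∧ (e = 1 ∨ e = 2) ∧ 2 ≤ a ∧ 3 * a ≤ n))
    (hs : n = 1 + (p - c)) : n ≤ 60 := by
  rcases Nat.eq_zero_or_pos c with hc | hc
  · simp [eq_zero_of_tca h hc]
  have h2 := two_mul_le_of_tca h
  obtain ⟨hp, hn, he, ha, h3⟩ := h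
  rcases he with rfl | rfl
  · have hc1 : c = 1 := by omega
    subst hc1
    rw [one_mul] at hp
    omega
  · omega

/-- Two classes of tori. [folklore] -/
lemma le_sixty_of_two {p₁ c₁ a₁ e₁ p₂ c₂ a₂ e₂ : ℕ}
    (h₁ : (p₁ = c₁ * a₁ ∧ n = e₁ * p₁ ∧ (e₁ = 1 ∨ e₁ = 2) ∧ 2 ≤ a₁ ∧ 3 * a₁ ≤ n))
    (h₂ : (p₂ = c₂ * a₂ ∧ n = e₂ * p₂ ∧ (e₂ = 1 ∨ e₂ = 2) ∧ 2 ≤ a₂ ∧ 3 * a₂ ≤ n))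
    (hs : n = 1 + (p₁ - c₁) + (p₂ - c₂)) : n ≤ 60 := by
  rcases Nat.eq_zero_or_pos c₁ with hc | hc₁
  · simp [eq_zero_of_tca h₁ hc]
  rcases Nat.eq_zero_or_pos c₂ with hc | hc₂
  · simp [eq_zero_of_tca h₂ hc]
  have k₁ := two_mul_le_of_tca h₁
  have k₂ := two_mul_le_of_tca h₂
  -- the mixed case `e = (1, 2)`, stated once and used twice
  have mixed : ∀ {p c a p' c' a' : ℕ},
      (p = c * a ∧ n = 1 * p ∧ (1 = 1 ∨ 1 = 2) ∧ 2 ≤ a ∧ 3 * a ≤ n) →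
      (p' = c' * a' ∧ n = 2 * p' ∧ (2 = 1 ∨ 2 = 2) ∧ 2 ≤ a' ∧ 3 * a' ≤ n) →
      0 < c → 0 < c' → n = 1 + (p - c) + (p' - c') → n ≤ 60 := by
    intro p c a p' c' a' h h' hc hc' hs
    have k := two_mul_le_of_tca h
    have k' := two_mul_le_of_tca h'
    obtain ⟨hp, hn, -, ha, h3⟩ := h
    obtain ⟨hp', hn', -, ha', h3'⟩ := h'
    rcases le_or_gt a 3 with ha3 | ha3
    · interval_cases a
      · -- `a = 2`: `c' = 1`, `p' = a'`, `3a' ≤ 2a'`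
        have hc1 : c' = 1 := by omega
        subst hc1
        rw [one_mul] at hp'
        omega
      · -- `a = 3`
        rcases le_or_gt a' 2 with ha2 | ha2
        · interval_cases a'
          omega
        · have : 3 * c' ≤ p' := mul_le_of_eq_mul hp' (by omega)
          omega
    · have : 4 * c ≤ p := mul_le_of_eq_mul hp (by omega)
      omega
  obtain ⟨hp₁, hn₁, he₁, ha₁, h3₁⟩ := id h₁
  obtain ⟨hp₂, hn₂, he₂, ha₂, h3₂⟩ := id h₂
  rcases he₁ with rfl | rfl <;> rcases he₂ with rfl | rfl
  · omega
  · exact mixed h₁ h₂ hc₁ hc₂ hs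
  · exact mixed h₂ h₁ hc₂ hc₁ (by omega)
  · omega

/-- Three classes of tori, all with `e = 2`, the first with `a = 2` and the second with
`a ≤ 3`. [folklore] -/
lemma le_sixty_of_three_aux {p c₁ c₂ a₂ c₃ a₃ : ℕ} (hn : n = 2 * p) (h₁ : p = c₁ * 2)
    (h₂ : p = c₂ * a₂) (ha₂ : 2 ≤ a₂) (ha₂' : a₂ ≤ 3) (h₃ : p = c₃ * a₃) (ha₃ : 2 ≤ a₃)
    (h3₃ : 3 * a₃ ≤ n) (hs : c₁ + c₂ + c₃ = p + 1) : n ≤ 60 := by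
  interval_cases a₂
  · -- `a₂ = 2`: `c₃ = 1`
    have hc : c₃ = 1 := by omega
    subst hc
    omega
  · -- `a₂ = 3`: `6 c₃ = p + 6`, so `a₃ ≤ 5`
    rcases le_or_gt a₃ 5 with ha | ha
    · interval_cases a₃ <;> omega
    · have : 6 * c₃ ≤ p := mul_le_of_eq_mul h₃ (by omega)
      omega

/-- Three classes of tori. [folklore] -/
lemma le_sixty_of_three {p₁ c₁ a₁ e₁ p₂ c₂ a₂ e₂ p₃ c₃ a₃ e₃ : ℕ}
    (h₁ : (p₁ = c₁ * a₁ ∧ n = e₁ * p₁ ∧ (e₁ = 1 ∨ e₁ = 2) ∧ 2 ≤ a₁ ∧ 3 * a₁ ≤ n))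
    (h₂ : (p₂ = c₂ * a₂ ∧ n = e₂ * p₂ ∧ (e₂ = 1 ∨ e₂ = 2) ∧ 2 ≤ a₂ ∧ 3 * a₂ ≤ n))
    (h₃ : (p₃ = c₃ * a₃ ∧ n = e₃ * p₃ ∧ (e₃ = 1 ∨ e₃ = 2) ∧ 2 ≤ a₃ ∧ 3 * a₃ ≤ n))
    (hs : n = 1 + (p₁ - c₁) + (p₂ - c₂) + (p₃ - c₃)) : n ≤ 60 := by
  rcases Nat.eq_zero_or_pos c₁ with hc | hc₁
  · simp [eq_zero_of_tca h₁ hc]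
  rcases Nat.eq_zero_or_pos c₂ with hc | hc₂
  · simp [eq_zero_of_tca h₂ hc]
  rcases Nat.eq_zero_or_pos c₃ with hc | hc₃
  · simp [eq_zero_of_tca h₃ hc]
  have k₁ := two_mul_le_of_tca h₁
  have k₂ := two_mul_le_of_tca h₂
  have k₃ := two_mul_le_of_tca h₃
  obtain ⟨hp₁, hn₁, he₁, ha₁, h3₁⟩ := id h₁
  obtain ⟨hp₂, hn₂, he₂, ha₂, h3₂⟩ := id h₂
  obtain ⟨hp₃, hn₃, he₃, ha₃, h3₃⟩ := id h₃
  -- if some `e = 1` the classes are too big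
  rcases he₁ with rfl | rfl
  · rcases he₂ with rfl | rfl <;> rcases he₃ with rfl | rfl <;> omega
  rcases he₂ with rfl | rfl
  · rcases he₃ with rfl | rfl <;> omega
  rcases he₃ with rfl | rfl
  · omega
  -- all `e = 2`: `p₁ = p₂ = p₃ =: p`, `c₁ + c₂ + c₃ = p + 1`
  have hp₂₁ : p₂ = p₁ := by omega
  have hp₃₁ : p₃ = p₁ := by omega
  -- with `a = 2` first and `a' ≤ 3` second we conclude by the auxiliary lemma
  have key : ∀ {c a c' a' c'' a'' : ℕ}, p₁ = c * a → p₁ = c' * a' → p₁ = c'' * a'' →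
      a = 2 → 2 ≤ a' → a' ≤ 3 → 2 ≤ a'' → 3 * a'' ≤ n → c + c' + c'' = p₁ + 1 → n ≤ 60 := by
    intro c a c' a' c'' a'' hp hp' hp'' ha ha' ha'3 ha'' h3'' hsum
    subst ha
    exact le_sixty_of_three_aux hn₁ hp hp' ha' ha'3 hp'' ha'' h3'' hsum
  have hsum : c₁ + c₂ + c₃ = p₁ + 1 := by omega
  -- some `a = 2`
  have hsome : a₁ = 2 ∨ a₂ = 2 ∨ a₃ = 2 := by
    by_contra hcon
    push Not at hcon
    have i₁ : 3 * c₁ ≤ p₁ := mul_le_of_eq_mul hp₁ (by omega)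
    have i₂ : 3 * c₂ ≤ p₂ := mul_le_of_eq_mul hp₂ (by omega)
    have i₃ : 3 * c₃ ≤ p₃ := mul_le_of_eq_mul hp₃ (by omega)
    omega
  -- given `a = 2` for one class, one of the other two has `a ≤ 3`
  have hother : ∀ {c a c' a' c'' a'' : ℕ}, p₁ = c * a → p₁ = c' * a' → p₁ = c'' * a'' →
      a = 2 → 2 ≤ a' → 2 ≤ a'' → c + c' + c'' = p₁ + 1 → a' ≤ 3 ∨ a'' ≤ 3 := by
    intro c a c' a' c'' a'' hp hp' hp'' ha ha' ha'' hsum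
    subst ha
    by_contra hcon
    push Not at hcon
    have i' : 4 * c' ≤ p₁ := mul_le_of_eq_mul hp' (by omega)
    have i'' : 4 * c'' ≤ p₁ := mul_le_of_eq_mul hp'' (by omega)
    omega
  rw [hp₂₁] at hp₂
  rw [hp₃₁] at hp₃
  rcases hsome with ha | ha | ha
  · rcases hother hp₁ hp₂ hp₃ ha ha₂ ha₃ hsum with h | h
    · exact key hp₁ hp₂ hp₃ ha ha₂ h ha₃ h3₃ hsum
    · exact key hp₁ hp₃ hp₂ ha ha₃ h ha₂ h3₂ (by omega)
  · rcases hother hp₂ hp₁ hp₃ ha ha₁ ha₃ (by omega) with h | h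
    · exact key hp₂ hp₁ hp₃ ha ha₁ h ha₃ h3₃ (by omega)
    · exact key hp₂ hp₃ hp₁ ha ha₃ h ha₁ h3₁ (by omega)
  · rcases hother hp₃ hp₁ hp₂ ha ha₁ ha₂ (by omega) with h | h
    · exact key hp₃ hp₁ hp₂ ha ha₁ h ha₂ h3₂ (by omega)
    · exact key hp₃ hp₂ hp₁ ha ha₂ h ha₁ h3₁ (by omega)


/-- **Counting lemma** (the group theory behind Dickson's cases (b)–(d)). Let `G` be a finite
group in which commutation is transitive off the centre `Z` (so the centralisers `C(x)`,
`x ∉ Z`, are abelian and partition `G ∖ Z`) and every such centraliser has index `≤ 2` in its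
normaliser. If every `C(x)`, `x ∉ Z`, has index `≥ 3` in `G`, then `[G : Z] ≤ 60`.
(Proof: count `G ∖ Z` along the conjugacy classes of the `C(x)`; the class of `C(x)` has
`[G : N(C(x))] (|C(x)| - |Z|) ≥ |G|/4` elements, so there are at most three classes, and the
resulting equation `1 - 1/n = Σ (1 - 1/aᵢ)/eᵢ` has no solution with `n > 60`.) [folklore] -/
theorem card_le_sixty_mul_card_center [Finite G]
    (hCT : ∀ x y : G, x ∉ center G → y ∉ center G → y ∈ centralizer ({x} : Set G) →
      centralizer ({y} : Set G) = centralizer {x})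
    (hN : ∀ x : G, x ∉ center G →
      Nat.card (normalizer (centralizer ({x} : Set G) : Set G)) ≤
        2 * Nat.card (centralizer ({x} : Set G)))
    (h3 : ∀ x : G, x ∉ center G → 3 * Nat.card (centralizer ({x} : Set G)) ≤ Nat.card G) :
    Nat.card G ≤ 60 * Nat.card (center G) := by
  classical
  haveI := Fintype.ofFinite G
  set Z := center G with hZ
  set z := Nat.card Z with hz
  have hz0 : 0 < z := Nat.card_pos
  obtain ⟨n, hgn⟩ : z ∣ Nat.card G := card_subgroup_dvd_card Z
  have hg0 : 0 < Nat.card G := Nat.card_pos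
  have hn0 : 0 < n := by
    rcases Nat.eq_zero_or_pos n with h | h
    · rw [h, mul_zero] at hgn; omega
    · exact h
  suffices hn60 : n ≤ 60 by
    rw [hgn, mul_comm]; exact Nat.mul_le_mul_right z hn60
  -- notation
  set C : G → Subgroup G := fun x ↦ centralizer {x} with hC
  set Zf : Finset G := Finset.univ.filter (· ∈ Z) with hZf
  set X : Finset G := Finset.univ.filter (· ∉ Z) with hX
  set cls : G → Finset G := fun x ↦ X.filter (fun y ↦ C y ∈ orbit (ConjAct G) (C x)) with hcls
  set 𝒪 : Finset (Finset G) := X.image cls with h𝒪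
  have hmemX : ∀ {x}, x ∈ X ↔ x ∉ Z := by simp [hX]
  have hZfcard : Zf.card = z := by
    rw [hz, Nat.card_eq_fintype_card, ← Fintype.card_subtype]
  -- `|X| + |Z| = |G|`
  have hXn : X.card + z = z * n := by
    rw [← hgn, Nat.card_eq_fintype_card, ← Finset.card_univ, ← hZfcard, add_comm]
    exact Finset.card_filter_add_card_filter_not (fun x ↦ x ∈ Z)
  -- `x ∈ C x`, `Z ≤ C x`
  have hxC : ∀ x, x ∈ C x := fun x ↦ mem_centralizer_singleton_iff.mpr rfl
  have hZC : ∀ x, Z ≤ C x := fun x ↦ center_le_centralizer _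
  -- fibres of `C` on `X`: `{y ∈ X | C y = C x'} = C x' ∖ Z`
  have hfiber : ∀ x', x' ∉ Z → (X.filter (fun y ↦ C y = C x')).card + z = Nat.card (C x') := by
    intro x' hx'
    set Cf : Finset G := Finset.univ.filter (· ∈ C x') with hCf
    have hCfcard : Cf.card = Nat.card (C x') := by
      rw [Nat.card_eq_fintype_card, ← Fintype.card_subtype]
    have hset : X.filter (fun y ↦ C y = C x') = Cf \ Zf := by
      ext y
      simp only [Finset.mem_filter, Finset.mem_sdiff, Finset.mem_univ, true_and, hX, hCf, hZf]
      constructor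
      · rintro ⟨hyZ, hyC⟩
        exact ⟨hyC ▸ hxC y, hyZ⟩
      · rintro ⟨hyC, hyZ⟩
        exact ⟨hyZ, hCT x' y hx' hyZ hyC⟩
    have hsub : Zf ⊆ Cf := by
      intro y hy
      simp only [Finset.mem_filter, Finset.mem_univ, true_and, hZf, hCf] at hy ⊢
      exact hZC x' hy
    rw [hset, ← hCfcard, ← hZfcard]
    exact Finset.card_sdiff_add_card_eq_card hsub
  -- members of the orbit of `C x` are centralisers of conjugates of `x`
  have horb : ∀ x, x ∉ Z → ∀ T ∈ orbit (ConjAct G) (C x),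
      ∃ x', x' ∉ Z ∧ T = C x' ∧ Nat.card T = Nat.card (C x) := by
    intro x hx T hT
    obtain ⟨k, rfl⟩ := mem_orbit_iff.mp hT
    refine ⟨ConjAct.ofConjAct k * x * (ConjAct.ofConjAct k)⁻¹, fun h ↦ hx ?_, ?_,
      nat_card_conjAct_smul k (C x)⟩
    · have := (inferInstance : (center G).Normal).conj_mem _ h (ConjAct.ofConjAct k)⁻¹
      simpa [mul_assoc] using this
    · change k • centralizer {x} = centralizer {_}
      rw [← conjAct_smul_centralizer, ConjAct.toConjAct_ofConjAct]
  -- the size of a class: `|cls x| · |N(C x)| + |G| z = |G| · |C x|`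
  have hclscard : ∀ x, x ∉ Z → (cls x).card * Nat.card (normalizer (C x : Set G)) +
      Nat.card G * z = Nat.card G * Nat.card (C x) := by
    intro x hx
    have hfin : (orbit (ConjAct G) (C x)).Finite := Set.finite_range _
    set t : Finset (Subgroup G) := hfin.toFinset with ht
    have hmem : ∀ y ∈ cls x, C y ∈ t := by
      intro y hy
      rw [ht, Set.Finite.mem_toFinset]
      exact (Finset.mem_filter.mp hy).2
    have hsum := Finset.card_eq_sum_card_fiberwise hmem
    have hterm : ∀ T ∈ t, ((cls x).filter (fun y ↦ C y = T)).card + z = Nat.card (C x) := by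
      intro T hT
      rw [ht, Set.Finite.mem_toFinset] at hT
      obtain ⟨x', hx', rfl, hcardT⟩ := horb x hx _ hT
      rw [← hcardT, ← hfiber x' hx']
      congr 2
      ext y
      simp only [hcls, Finset.mem_filter]
      constructor
      · rintro ⟨⟨hy, -⟩, h⟩; exact ⟨hy, h⟩
      · rintro ⟨hy, h⟩; exact ⟨⟨hy, h ▸ hT⟩, h⟩
    have hsum' : (cls x).card + t.card * z = t.card * Nat.card (C x) := by
      have h1 : ∑ T ∈ t, (((cls x).filter fun y ↦ C y = T).card + z) =
          ∑ T ∈ t, Nat.card (C x) := Finset.sum_congr rfl hterm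
      rw [Finset.sum_add_distrib, Finset.sum_const, Finset.sum_const, smul_eq_mul, smul_eq_mul,
        ← hsum] at h1
      exact h1
    have htcard : t.card = Nat.card (orbit (ConjAct G) (C x)) := by
      rw [ht, ← Set.ncard_eq_toFinset_card _ hfin, Nat.card_coe_set_eq]
    have hos := nat_card_orbit_mul_card_normalizer (C x)
    rw [← htcard] at hos
    calc (cls x).card * Nat.card (normalizer (C x : Set G)) + Nat.card G * z
        = ((cls x).card + t.card * z) * Nat.card (normalizer (C x : Set G)) := by
          rw [← hos]; ring
      _ = t.card * Nat.card (C x) * Nat.card (normalizer (C x : Set G)) := by rw [hsum']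
      _ = Nat.card G * Nat.card (C x) := by rw [← hos]; ring
  -- arithmetic data of each class
  have hdata : ∀ x, x ∉ Z →
      ∃ p c a e, (p = c * a ∧ n = e * p ∧ (e = 1 ∨ e = 2) ∧ 2 ≤ a ∧ 3 * a ≤ n) ∧
        (cls x).card = z * (p - c) := by
    intro x hx
    obtain ⟨a, ha⟩ : z ∣ Nat.card (C x) := card_dvd_of_le (hZC x)
    obtain ⟨e, he⟩ : Nat.card (C x) ∣ Nat.card (normalizer (C x : Set G)) :=
      card_dvd_of_le le_normalizer
    obtain ⟨c, hc⟩ : Nat.card (normalizer (C x : Set G)) ∣ Nat.card G :=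
      card_subgroup_dvd_card _
    have hCpos : 0 < Nat.card (C x) := Nat.card_pos
    -- `a ≠ 0, 1`: otherwise `C x = Z ∋ x`
    have ha2 : 2 ≤ a := by
      by_contra h1
      rcases Nat.eq_zero_or_pos a with h0 | h0
      · rw [h0, mul_zero] at ha; omega
      have ha1 : a = 1 := by omega
      rw [ha1, mul_one] at ha
      have : Z = C x := eq_of_le_of_card_ge (hZC x) (by rw [ha])
      exact hx (this ▸ hxC x)
    have he12 : e = 1 ∨ e = 2 := by
      have h2 := hN x hx
      rw [he] at h2
      have hle : e ≤ 2 := by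
        by_contra h
        have : Nat.card (C x) * 3 ≤ Nat.card (C x) * e := Nat.mul_le_mul_left _ (by omega)
        linarith
      have hne : e ≠ 0 := by
        rintro rfl
        have : 0 < Nat.card (normalizer (C x : Set G)) := Nat.card_pos
        rw [he, mul_zero] at this
        exact lt_irrefl _ this
      omega
    have hnz : n = a * e * c := by
      apply Nat.eq_of_mul_eq_mul_left hz0
      rw [← hgn, hc, he, ha]; ring
    have h3a : 3 * a ≤ n := by
      have := h3 x hx
      rw [ha, hgn] at this
      refine Nat.le_of_mul_le_mul_left ?_ hz0
      calc z * (3 * a) = 3 * (z * a) := by ring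
        _ ≤ z * n := this
    refine ⟨c * a, c, a, e, ⟨rfl, by rw [hnz]; ring, he12, ha2, h3a⟩, ?_⟩
    -- class size
    have hcl := hclscard x hx
    rw [hc, he, ha] at hcl
    have hzae : 0 < z * a * e := by
      have : 0 < e := by omega
      positivity
    have key : z * a * e * ((cls x).card + z * c) = z * a * e * (z * (c * a)) := by
      calc z * a * e * ((cls x).card + z * c)
          = (cls x).card * (z * a * e) + z * a * e * c * z := by ring
        _ = z * a * e * c * (z * a) := hcl
        _ = z * a * e * (z * (c * a)) := by ring
    have key' := Nat.eq_of_mul_eq_mul_left hzae key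
    rw [mul_tsub]
    omega
  -- classes: `y ∈ cls x → cls y = cls x`, `x ∈ cls x`
  have hcls_eq : ∀ x y, y ∈ cls x → cls y = cls x := by
    intro x y hy
    have hy' : C y ∈ orbit (ConjAct G) (C x) := (Finset.mem_filter.mp hy).2
    have horbeq : orbit (ConjAct G) (C y) = orbit (ConjAct G) (C x) := orbit_eq_iff.mpr hy'
    simp only [hcls, horbeq]
  have hmem_cls : ∀ x ∈ X, x ∈ cls x := fun x hx ↦
    Finset.mem_filter.mpr ⟨hx, mem_orbit_self _⟩
  -- `X` is the disjoint union of the classes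
  have hdisj : (𝒪 : Set (Finset G)).PairwiseDisjoint id := by
    intro K₁ hK₁ K₂ hK₂ hne
    obtain ⟨x₁, -, rfl⟩ := Finset.mem_image.mp (Finset.mem_coe.mp hK₁)
    obtain ⟨x₂, -, rfl⟩ := Finset.mem_image.mp (Finset.mem_coe.mp hK₂)
    rw [Function.onFun, Finset.disjoint_left]
    intro y hy₁ hy₂
    exact hne ((hcls_eq x₁ y hy₁).symm.trans (hcls_eq x₂ y hy₂))
  have hcover : X = 𝒪.biUnion id := by
    ext y
    simp only [Finset.mem_biUnion, Finset.mem_image, h𝒪, id, exists_exists_and_eq_and]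
    constructor
    · intro hy; exact ⟨y, hy, hmem_cls y hy⟩
    · rintro ⟨x, -, hyx⟩; exact (Finset.mem_filter.mp hyx).1
  have hXsum : X.card = ∑ K ∈ 𝒪, K.card := by
    conv_lhs => rw [hcover]
    rw [Finset.card_biUnion hdisj]
    rfl
  -- arithmetic data of each class, and each class is big: at most three classes
  have hrep : ∀ K ∈ 𝒪, ∃ p c a e, (p = c * a ∧ n = e * p ∧ (e = 1 ∨ e = 2) ∧ 2 ≤ a ∧ 3 * a ≤ n) ∧
      K.card = z * (p - c) := by
    intro K hK
    obtain ⟨x, hx, rfl⟩ := Finset.mem_image.mp hK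
    exact hdata x (hmemX.mp hx)
  have hbig : ∀ K ∈ 𝒪, z * n ≤ 4 * K.card := by
    intro K hK
    obtain ⟨p, c, a, e, hT, hcard⟩ := hrep K hK
    have h2c := two_mul_le_of_tca hT
    obtain ⟨-, hn, he, -, -⟩ := hT
    have hn2 : n ≤ 2 * p := by rcases he with rfl | rfl <;> omega
    rw [hcard]
    calc z * n ≤ z * (4 * (p - c)) := Nat.mul_le_mul_left _ (by omega)
      _ = 4 * (z * (p - c)) := by ring
  have hOcard : 𝒪.card ≤ 3 := by
    have h1 : 𝒪.card • (z * n) ≤ ∑ K ∈ 𝒪, 4 * K.card := Finset.card_nsmul_le_sum _ _ _ hbig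
    rw [← Finset.mul_sum, ← hXsum, smul_eq_mul] at h1
    by_contra h
    have : 4 * (z * n) ≤ 𝒪.card * (z * n) := Nat.mul_le_mul_right _ (by omega)
    have hzn : 0 < z * n := by positivity
    omega
  -- case analysis on the number of classes
  rcases Nat.lt_or_ge 𝒪.card 1 with h0 | h1
  · -- no class: `X = ∅`, `n = 1`
    have hO : 𝒪 = ∅ := Finset.card_eq_zero.mp (show 𝒪.card = 0 by omega)
    rw [hO, Finset.sum_empty] at hXsum
    have : z * n = z * 1 := by omega
    have := Nat.eq_of_mul_eq_mul_left hz0 this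
    omega
  rcases Nat.lt_or_ge 𝒪.card 2 with h1' | h2
  · obtain ⟨K₁, hO⟩ := Finset.card_eq_one.mp (show 𝒪.card = 1 by omega)
    obtain ⟨p₁, c₁, a₁, e₁, hT₁, hK₁⟩ := hrep K₁ (by rw [hO]; simp)
    rw [hO, Finset.sum_singleton, hK₁] at hXsum
    refine le_sixty_of_one hT₁ (Nat.eq_of_mul_eq_mul_left hz0 ?_)
    rw [mul_add, mul_one]
    omega
  rcases Nat.lt_or_ge 𝒪.card 3 with h2' | h3'
  · obtain ⟨K₁, K₂, hne, hO⟩ := Finset.card_eq_two.mp (show 𝒪.card = 2 by omega)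
    obtain ⟨p₁, c₁, a₁, e₁, hT₁, hK₁⟩ := hrep K₁ (by rw [hO]; simp)
    obtain ⟨p₂, c₂, a₂, e₂, hT₂, hK₂⟩ := hrep K₂ (by rw [hO]; simp)
    rw [hO, Finset.sum_pair hne, hK₁, hK₂] at hXsum
    refine le_sixty_of_two hT₁ hT₂ (Nat.eq_of_mul_eq_mul_left hz0 ?_)
    rw [mul_add, mul_add, mul_one]
    omega
  · obtain ⟨K₁, K₂, K₃, h12, h13, h23, hO⟩ := Finset.card_eq_three.mp (show 𝒪.card = 3 by omega)
    obtain ⟨p₁, c₁, a₁, e₁, hT₁, hK₁⟩ := hrep K₁ (by rw [hO]; simp)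
    obtain ⟨p₂, c₂, a₂, e₂, hT₂, hK₂⟩ := hrep K₂ (by rw [hO]; simp)
    obtain ⟨p₃, c₃, a₃, e₃, hT₃, hK₃⟩ := hrep K₃ (by rw [hO]; simp)
    rw [hO, Finset.sum_insert (by simp [h12, h13]), Finset.sum_pair h23, hK₁, hK₂, hK₃] at hXsum
    refine le_sixty_of_three hT₁ hT₂ hT₃ (Nat.eq_of_mul_eq_mul_left hz0 ?_)
    rw [mul_add, mul_add, mul_add, mul_one]
    omega

end Literature.NumberTheory.GaloisRepresentations.DeligneSerre1974.Counting

/-! ## Case (a): `ℓ ∣ |G|` -/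

namespace Literature.NumberTheory.GaloisRepresentations.DeligneSerre1974

open Matrix TwoByTwo

variable {ℓ : ℕ} [Fact ℓ.Prime]

/-! Throughout, for an element `g` of a subgroup `G` of `GL₂(𝔽_ℓ)` we write `g.1.1` for its
matrix (the double coercion `↥G → GL (Fin 2) (ZMod ℓ) → Matrix (Fin 2) (Fin 2) (ZMod ℓ)`); the
docstrings call it `mat g`. -/

section Mat
variable {G : Subgroup (GL (Fin 2) (ZMod ℓ))}

/-- `mat` is multiplicative. [folklore] -/
lemma mat_mul (g h : G) : (g * h).1.1 = g.1.1 * h.1.1 := by simp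
/-- `mat 1 = 1`. [folklore] -/
lemma mat_one : (1 : G).1.1 = 1 := by simp
/-- `mat` commutes with inversion. [folklore] -/
lemma mat_inv (g : G) : (g⁻¹).1.1 = (g.1.1)⁻¹ := by simp [Matrix.coe_units_inv]
/-- `mat` commutes with powers. [folklore] -/
lemma mat_pow (g : G) (n : ℕ) : (g ^ n).1.1 = g.1.1 ^ n := by
  simp [Units.val_pow_eq_pow_val]
/-- `mat` is injective. [folklore] -/
lemma mat_injective {g h : G} (hgh : g.1.1 = h.1.1) : g = h := Subtype.ext (Units.ext hgh)

/-- `mat` is injective (as a function). [folklore] -/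
lemma mat_injective' : Function.Injective (fun g : G ↦ g.1.1) := fun _ _ h ↦ mat_injective h
/-- Matrices of group elements are invertible. [folklore] -/
lemma det_mat_ne_zero (g : G) : (g.1.1).det ≠ 0 :=
  (Matrix.isUnit_iff_isUnit_det _ |>.mp (g : GL (Fin 2) (ZMod ℓ)).isUnit).ne_zero

end Mat

/-- **Semisimplicity excludes the Borel case.** If `G ⊆ GL₂(𝔽_ℓ)` is semisimple and contains
the transvection `1 + N` (`N ≠ 0`, `N² = 0`), then some `h ∈ G` moves the line `ker N = im N`,
i.e. `tr(hN) ≠ 0`. [folklore] -/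
lemma exists_trace_mul_ne_zero {G : Subgroup (GL (Fin 2) (ZMod ℓ))} (hG : IsSemisimpleSubgroup G)
    {N : Matrix (Fin 2) (Fin 2) (ZMod ℓ)} (hN0 : N ≠ 0) (hNN : N * N = 0) (hdet : N.det = 0)
    (g₀ : G) (hg₀N : g₀.1.1 = 1 + N) : ∃ h : G, (h.1.1 * N).trace ≠ 0 := by
  by_contra hall
  push Not at hall
  set f := Matrix.toLin' N with hf
  have hfapply : ∀ v, f v = N *ᵥ v := fun v ↦ Matrix.toLin'_apply N v
  -- `range f = ker f`
  have hrk : LinearMap.range f ≤ LinearMap.ker f := by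
    rintro _ ⟨v, rfl⟩
    rw [LinearMap.mem_ker, hfapply, hfapply, Matrix.mulVec_mulVec, hNN, Matrix.zero_mulVec]
  have hf0 : f ≠ 0 := fun h ↦ hN0 ((LinearEquiv.map_eq_zero_iff Matrix.toLin').mp h)
  have hfr : Module.finrank (ZMod ℓ) (LinearMap.range f) +
      Module.finrank (ZMod ℓ) (LinearMap.ker f) = 2 := by
    have := LinearMap.finrank_range_add_finrank_ker f
    rwa [Module.finrank_fin_fun] at this
  have hr1 : 1 ≤ Module.finrank (ZMod ℓ) (LinearMap.range f) := by
    rw [Nat.one_le_iff_ne_zero]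
    intro h0
    exact hf0 (LinearMap.range_eq_bot.mp (Submodule.finrank_eq_zero.mp h0))
  have heq : LinearMap.range f = LinearMap.ker f :=
    Submodule.eq_of_le_of_finrank_le hrk (by omega)
  -- the line `im N` is `G`-stable since every `h ∈ G` has `N h N = tr(hN) N = 0`
  set ρ := subgroupRepresentation G with hρ
  have hρapply : ∀ (g : G) (v : Fin 2 → ZMod ℓ), ρ g v = g.1.1 *ᵥ v := fun g v ↦ rfl
  have hstab : ∀ (g : G) ⦃v : Fin 2 → ZMod ℓ⦄, v ∈ LinearMap.range f →
      ρ g v ∈ LinearMap.range f := by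
    rintro g _ ⟨w, rfl⟩
    rw [heq, LinearMap.mem_ker, hfapply, hfapply, hρapply, Matrix.mulVec_mulVec,
      Matrix.mulVec_mulVec, mul_mul_self_of_det_eq_zero N _ hdet, hall g, zero_smul,
      Matrix.zero_mulVec]
  let W : Subrepresentation ρ := ⟨LinearMap.range f, hstab⟩
  haveI : ComplementedLattice (Subrepresentation ρ) := hG
  obtain ⟨W', hW'⟩ := exists_isCompl W
  have hinf : LinearMap.range f ⊓ W'.toSubmodule = ⊥ := by
    rw [← show W.toSubmodule = LinearMap.range f from rfl, ← Subrepresentation.toSubmodule_inf,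
      hW'.inf_eq_bot]
    rfl
  have hsup : LinearMap.range f ⊔ W'.toSubmodule = ⊤ := by
    rw [← show W.toSubmodule = LinearMap.range f from rfl, ← Subrepresentation.toSubmodule_sup,
      hW'.sup_eq_top]
    rfl
  -- the complement is `0`: `g₀ = 1 + N` stabilises it, so `N W' ⊆ W ∩ W' = 0`, `W' ⊆ ker N = W`
  have hW'bot : W'.toSubmodule = ⊥ := by
    rw [Submodule.eq_bot_iff]
    intro v hv
    have h1 : ρ g₀ v ∈ W'.toSubmodule := W'.apply_mem_toSubmodule g₀ hv
    rw [hρapply, hg₀N, Matrix.add_mulVec, Matrix.one_mulVec] at h1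
    have hNv : N *ᵥ v ∈ W'.toSubmodule := by simpa using W'.toSubmodule.sub_mem h1 hv
    have hNv' : N *ᵥ v ∈ LinearMap.range f := ⟨v, hfapply v⟩
    have hNv0 : N *ᵥ v = 0 := by
      have : N *ᵥ v ∈ LinearMap.range f ⊓ W'.toSubmodule := ⟨hNv', hNv⟩
      rw [hinf] at this
      exact (Submodule.mem_bot (ZMod ℓ)).mp this
    have hvW : v ∈ LinearMap.range f := by rw [heq, LinearMap.mem_ker, hfapply]; exact hNv0
    have : v ∈ LinearMap.range f ⊓ W'.toSubmodule := ⟨hvW, hv⟩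
    rw [hinf] at this
    exact (Submodule.mem_bot (ZMod ℓ)).mp this
  rw [hW'bot, sup_bot_eq] at hsup
  apply hf0
  rw [← LinearMap.ker_eq_top, ← heq, hsup]

/-- Powers of a transvection: `(1 + N)^i = 1 + i N` when `N² = 0`. [folklore] -/
lemma one_add_pow_of_mul_self_eq_zero {K : Type*} [Field K] {N : Matrix (Fin 2) (Fin 2) K}
    (hNN : N * N = 0) (i : ℕ) : (1 + N) ^ i = 1 + (i : K) • N := by
  have := smul_pow_smul_one_add (1 : K) hNN i
  simpa using this

/-- **Case (a) (`ℓ ∣ |G|`), the key count.** If `G ⊆ GL₂(𝔽_ℓ)` is semisimple of order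
divisible by `ℓ`, then for every `(τ, δ)` at most `2|G|/ℓ` elements of `G` have trace `τ` and
determinant `δ`. (Deligne–Serre treat this case through `G ⊇ SL₂(𝔽_ℓ)`, Dickson; here: a
transvection `g = 1 + N ∈ G` of order `ℓ` exists (Cauchy), the stabiliser `B` of its line has
index `≥ ℓ + 1` by semisimplicity, and on each coset of `⟨g⟩` outside `B` the trace takes every
value once.) [cite: DeligneSerreASENS1974, proof of Prop. 7.2, cas (a)] -/
theorem mul_card_filter_trace_det_le_of_dvd {G : Subgroup (GL (Fin 2) (ZMod ℓ))}
    (hG : IsSemisimpleSubgroup G) (hℓ : ℓ ∣ Nat.card G) (τ δ : ZMod ℓ) [Fintype G] :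
    ℓ * (Finset.univ.filter (fun g : G ↦ (g.1.1).trace = τ ∧ (g.1.1).det = δ)).card ≤
      2 * Nat.card G := by
  classical
  have hℓp : ℓ.Prime := Fact.out
  set S := Finset.univ.filter (fun g : G ↦ (g.1.1).trace = τ ∧ (g.1.1).det = δ) with hS
  -- a transvection `g = 1 + N` of order `ℓ`
  obtain ⟨g, hg⟩ := exists_prime_orderOf_dvd_card' (G := G) ℓ hℓ
  set N : Matrix (Fin 2) (Fin 2) (ZMod ℓ) := g.1.1 - 1 with hN
  have hgN : g.1.1 = 1 + N := by rw [hN]; abel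
  have hgℓ : g ^ ℓ = 1 := by have := pow_orderOf_eq_one g; rwa [hg] at this
  have hNℓ : N ^ ℓ = 0 := by
    rw [hN, sub_pow_char_of_commute ℓ (Commute.one_right _), one_pow, ← mat_pow, hgℓ, mat_one,
      sub_self]
  have htrN : N.trace = 0 := (Matrix.isNilpotent_trace_of_isNilpotent ⟨ℓ, hNℓ⟩).eq_zero
  have hdetN : N.det = 0 := by
    have : N.det ^ ℓ = 0 := by rw [← Matrix.det_pow, hNℓ]; simp
    exact pow_eq_zero_iff hℓp.ne_zero |>.mp this
  have hNN : N * N = 0 := by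
    rw [mul_self_eq N, htrN, hdetN, zero_smul, zero_smul, sub_zero]
  have hN0 : N ≠ 0 := by
    intro h0
    have : g = 1 := mat_injective (by rw [hgN, h0, add_zero, mat_one])
    rw [this, orderOf_one] at hg
    exact hℓp.one_lt.ne hg
  -- semisimplicity: some `h ∈ G` with `tr(hN) ≠ 0`
  obtain ⟨h, hh⟩ := exists_trace_mul_ne_zero hG hN0 hNN hdetN g hgN
  -- the stabiliser `B = {k | tr(kN) = 0}` of the line of `N`
  have hB_mul : ∀ k k' : G, (k.1.1 * N).trace = 0 → (k'.1.1 * N).trace = 0 →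
      ((k * k').1.1 * N).trace = 0 := by
    intro k k' hk hk'
    have h1 : k'.1.1 * N = (k'.1.1).trace • N - N * k'.1.1 := by
      have := mul_add_mul_eq (k'.1.1) N
      rw [htrN, hk', zero_smul, add_zero, mul_zero, sub_zero, zero_smul, add_zero] at this
      exact eq_sub_of_add_eq this
    have h2 : N * (k * k').1.1 * N = 0 := by
      calc N * (k * k').1.1 * N = N * k.1.1 * (k'.1.1 * N) := by
            rw [mat_mul, Matrix.mul_assoc, Matrix.mul_assoc, Matrix.mul_assoc]
        _ = (k'.1.1).trace • (N * k.1.1 * N) - N * k.1.1 * N * k'.1.1 := by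
            rw [h1, mul_sub, Matrix.mul_smul, Matrix.mul_assoc _ N (k'.1.1)]
        _ = 0 := by
            rw [mul_mul_self_of_det_eq_zero N _ hdetN, hk, zero_smul, smul_zero, zero_mul,
              sub_zero]
    have h3 := mul_mul_self_of_det_eq_zero N ((k * k').1.1) hdetN
    rw [h2] at h3
    rcases smul_eq_zero.mp h3.symm with h | h
    · exact h
    · exact absurd h hN0
  let Bm : Submonoid G :=
    { carrier := {k | (k.1.1 * N).trace = 0}
      one_mem' := by simp [htrN]
      mul_mem' := fun {k k'} hk hk' ↦ hB_mul k k' hk hk' }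
  have hBm : ∀ {k : G}, k ∈ Bm ↔ (k.1.1 * N).trace = 0 := Iff.rfl
  let B : Subgroup G :=
    { Bm with
      inv_mem' := fun {k} hk ↦ by
        have hk' : k⁻¹ = k ^ (orderOf k - 1) := by
          symm
          apply eq_inv_of_mul_eq_one_left
          rw [pow_sub_one_mul (orderOf_pos k).ne', pow_orderOf_eq_one]
        change k⁻¹ ∈ Bm
        rw [hk']
        exact pow_mem hk _ }
  have hB : ∀ {k : G}, k ∈ B ↔ (k.1.1 * N).trace = 0 := Iff.rfl
  have hhB : h ∉ B := fun hb ↦ hh (hB.mp hb)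
  -- the cyclic group `U = ⟨g⟩ ≤ B`
  set U : Subgroup G := Subgroup.zpowers g with hU
  have hUcard : Nat.card U = ℓ := by rw [hU, Nat.card_zpowers, hg]
  have hgB : g ∈ B := by
    rw [hB, hgN, add_mul, one_mul, hNN, add_zero, htrN]
  have hUB : U ≤ B := by rw [hU]; exact Subgroup.zpowers_le.mpr hgB
  have hUmat : ∀ u ∈ U, ∃ c : ZMod ℓ, u.1.1 = 1 + c • N := by
    intro u hu
    obtain ⟨i, rfl⟩ := Submonoid.mem_powers_iff _ _ |>.mp ((mem_powers_iff_mem_zpowers).mpr hu)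
    exact ⟨i, by rw [mat_pow, hgN, one_add_pow_of_mul_self_eq_zero hNN]⟩
  -- membership in `S`
  have hmemS : ∀ {k : G}, k ∈ S ↔ (k.1.1).trace = τ ∧ (k.1.1).det = δ := by simp [hS]
  -- (i) outside `B`, the trace separates the points of each coset of `U`
  set S₁ := S.filter (· ∉ B) with hS₁
  set S₂ := S.filter (· ∈ B) with hS₂
  have hScard : S.card = S₂.card + S₁.card :=
    (Finset.card_filter_add_card_filter_not (fun k : G ↦ k ∈ B)).symm
  have hS₁ : S₁.card ≤ U.index := by
    rw [Subgroup.index_eq_card, Nat.card_eq_fintype_card, ← Finset.card_univ]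
    refine Finset.card_le_card_of_injOn (QuotientGroup.mk (s := U)) (fun _ _ ↦ Finset.mem_univ _)
      ?_
    intro k hk k' hk' hkk'
    obtain ⟨hkS, hkB⟩ := Finset.mem_filter.mp (Finset.mem_coe.mp hk)
    obtain ⟨hk'S, -⟩ := Finset.mem_filter.mp (Finset.mem_coe.mp hk')
    obtain ⟨c, hc⟩ := hUmat _ (QuotientGroup.eq.mp hkk')
    have hk'c : k'.1.1 = k.1.1 + c • (k.1.1 * N) := by
      rw [← mul_inv_cancel_left k k', mat_mul, hc, mul_add, mul_one, Matrix.mul_smul]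
    have htr := congrArg Matrix.trace hk'c
    rw [Matrix.trace_add, Matrix.trace_smul, (hmemS.mp hk'S).1, (hmemS.mp hkS).1, smul_eq_mul,
      left_eq_add, mul_eq_zero] at htr
    rcases htr with hc0 | htr0
    · apply mat_injective
      rw [hk'c, hc0, zero_smul, add_zero]
    · exact absurd htr0 hkB
  -- (ii) inside `B`
  have hS₂ : S₂.card ≤ Nat.card B := by
    have hBc : (Finset.univ.filter (· ∈ B)).card = Nat.card B := by
      rw [Nat.card_eq_fintype_card, ← Fintype.card_subtype]
    rw [← hBc]
    exact Finset.card_le_card (fun k hk ↦ by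
      simpa using (Finset.mem_filter.mp hk).2)
  -- (iii) `B` has at least `ℓ + 1` cosets: `B` and `uₓ h B`, `uₓ = g ^ x`
  have hBidx : ℓ + 1 ≤ B.index := by
    let φ : Option (ZMod ℓ) → G ⧸ B := fun o ↦
      o.elim (QuotientGroup.mk 1) (fun x ↦ QuotientGroup.mk (g ^ x.val * h))
    have hu : ∀ x : ZMod ℓ, g ^ x.val ∈ B := fun x ↦ hUB (Subgroup.npow_mem_zpowers g _)
    have hφ : Function.Injective φ := by
      intro o o' hoo'
      cases o with
      | none =>
        cases o' with
        | none => rfl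
        | some y =>
          exfalso
          have := QuotientGroup.eq.mp hoo'
          rw [inv_one, one_mul] at this
          exact hhB ((Subgroup.mul_mem_cancel_left B (hu y)).mp this)
      | some x =>
        cases o' with
        | none =>
          exfalso
          have := QuotientGroup.eq.mp hoo'.symm
          rw [inv_one, one_mul] at this
          exact hhB ((Subgroup.mul_mem_cancel_left B (hu x)).mp this)
        | some y =>
          have hβ := QuotientGroup.eq.mp hoo'
          -- `β = h⁻¹ w h` with `w = (g^x)⁻¹ g^y ∈ U`
          set w : G := (g ^ x.val)⁻¹ * g ^ y.val with hw
          have hwU : w ∈ U := U.mul_mem (U.inv_mem (Subgroup.npow_mem_zpowers g _))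
            (Subgroup.npow_mem_zpowers g _)
          obtain ⟨c, hc⟩ := hUmat w hwU
          have hβw : (g ^ x.val * h)⁻¹ * (g ^ y.val * h) = h⁻¹ * w * h := by
            rw [hw]; group
          rw [hβw, hB, mat_mul, mat_mul, mat_inv, hc] at hβ
          -- `tr(h⁻¹ (1 + cN) h N) = c · tr(hN) · tr(h⁻¹N)`
          have hdh : IsUnit (h.1.1).det := (Ne.isUnit (det_mat_ne_zero h))
          have key : ((h.1.1)⁻¹ * (1 + c • N) * h.1.1 * N).trace =
              c * ((h.1.1 * N).trace * ((h.1.1)⁻¹ * N).trace) := by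
            have e1 : (h.1.1)⁻¹ * (1 + c • N) * h.1.1 * N =
                (h.1.1)⁻¹ * h.1.1 * N + c • ((h.1.1)⁻¹ * (N * h.1.1 * N)) := by
              rw [mul_add, mul_one, add_mul, add_mul, Matrix.mul_smul, Matrix.smul_mul,
                Matrix.smul_mul, Matrix.mul_assoc _ N (h.1.1), Matrix.mul_assoc _ (N * h.1.1) N]
            rw [e1, Matrix.nonsing_inv_mul _ hdh, one_mul, mul_mul_self_of_det_eq_zero N _ hdetN,
              Matrix.trace_add, htrN, zero_add, Matrix.mul_smul, Matrix.trace_smul,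
              Matrix.trace_smul, smul_eq_mul, smul_eq_mul]
          rw [key] at hβ
          have hh' : ((h.1.1)⁻¹ * N).trace ≠ 0 := by
            rw [← mat_inv]; exact fun h0 ↦ hhB (B.inv_mem_iff.mp (hB.mpr h0))
          have hc0 : c = 0 := by
            rcases mul_eq_zero.mp hβ with h0 | h0
            · exact h0
            · rcases mul_eq_zero.mp h0 with h0 | h0
              · exact absurd h0 hh
              · exact absurd h0 hh'
          rw [hc0, zero_smul, add_zero] at hc
          have hw1 : w = 1 := mat_injective (by rw [hc, mat_one])
          rw [hw, inv_mul_eq_one] at hw1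
          rw [pow_eq_pow_iff_modEq, hg] at hw1
          have := Nat.ModEq.eq_of_lt_of_lt hw1 (ZMod.val_lt x) (ZMod.val_lt y)
          rw [ZMod.val_injective ℓ this]
    have := Fintype.card_le_of_injective φ hφ
    rw [Fintype.card_option, ZMod.card] at this
    rwa [Subgroup.index_eq_card, Nat.card_eq_fintype_card]
  -- (iv) assemble
  have hUidx : U.index * ℓ = Nat.card G := by
    have := Subgroup.index_mul_card U; rwa [hUcard] at this
  have hBcard : B.index * Nat.card B = Nat.card G := Subgroup.index_mul_card B
  have hB' : (ℓ + 1) * Nat.card B ≤ Nat.card G := by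
    rw [← hBcard]; exact Nat.mul_le_mul_right _ hBidx
  calc ℓ * S.card = ℓ * S₁.card + ℓ * S₂.card := by rw [hScard]; ring
    _ ≤ ℓ * U.index + ℓ * Nat.card B :=
        add_le_add (Nat.mul_le_mul_left _ hS₁) (Nat.mul_le_mul_left _ hS₂)
    _ ≤ Nat.card G + (ℓ + 1) * Nat.card B := by
        rw [mul_comm ℓ U.index, hUidx]
        exact add_le_add (le_refl _) (Nat.mul_le_mul_right _ (Nat.le_succ ℓ))
    _ ≤ Nat.card G + Nat.card G := add_le_add (le_refl _) hB'
    _ = 2 * Nat.card G := by ring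


/-! ## Cases (b), (c), (d): `ℓ ∤ |G|` -/

section CasePrime

variable {G : Subgroup (GL (Fin 2) (ZMod ℓ))}

/-- A scalar element is central. [folklore] -/
lemma mem_center_of_mat_eq (x : G) {c : ZMod ℓ} (hx : x.1.1 = c • 1) : x ∈ Subgroup.center G := by
  rw [Subgroup.mem_center_iff]
  intro g
  apply mat_injective
  rw [mat_mul, mat_mul, hx, Matrix.mul_smul, Matrix.smul_mul, mul_one, one_mul]

/-- Group-level commutation is matrix commutation. [folklore] -/
lemma commute_iff_mat (x y : G) : y * x = x * y ↔ y.1.1 * x.1.1 = x.1.1 * y.1.1 := by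
  rw [← mat_mul, ← mat_mul]
  exact ⟨fun h ↦ by rw [h], fun h ↦ mat_injective h⟩

/-- If `Y = a + bX` and `Z` commutes with `X` then `Z` commutes with `Y`. [folklore] -/
lemma mul_eq_mul_of_eq_smul_one_add_smul {K : Type*} [Field K] {X Y Z : Matrix (Fin 2) (Fin 2) K}
    {a b : K} (hY : Y = a • 1 + b • X) (h : X * Z = Z * X) : Y * Z = Z * Y := by
  rw [hY, add_mul, mul_add, smul_mul_assoc, smul_mul_assoc, mul_smul_comm, mul_smul_comm, one_mul,
    mul_one, h]

/-- At most two matrices commuting with a non-scalar `X` of non-zero discriminant have a given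
trace and determinant (`char ≠ 2`). [folklore] -/
lemma card_le_two_of_commute {K : Type*} [Field K] [DecidableEq K] (h2 : (2 : K) ≠ 0)
    {X : Matrix (Fin 2) (Fin 2) K} (hns : ∀ c : K, X ≠ c • 1)
    (hdisc : X.trace ^ 2 - 4 * X.det ≠ 0) {τ δ : K} (T : Finset (Matrix (Fin 2) (Fin 2) K))
    (hT : ∀ m ∈ T, X * m = m * X ∧ m.trace = τ ∧ m.det = δ) : T.card ≤ 2 := by
  by_contra hlt
  obtain ⟨m₁, hm₁, m₂, hm₂, m₃, hm₃, h₁₂, h₁₃, h₂₃⟩ := Finset.two_lt_card.mp (not_le.mp hlt)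
  obtain ⟨hc₁, ht₁, hd₁⟩ := hT m₁ hm₁
  obtain ⟨hc₂, ht₂, hd₂⟩ := hT m₂ hm₂
  obtain ⟨hc₃, ht₃, hd₃⟩ := hT m₃ hm₃
  obtain ⟨a₁, b₁, rfl⟩ := exists_eq_smul_one_add_smul_of_commute hns hc₁
  obtain ⟨a₂, b₂, rfl⟩ := exists_eq_smul_one_add_smul_of_commute hns hc₂
  obtain ⟨a₃, b₃, rfl⟩ := exists_eq_smul_one_add_smul_of_commute hns hc₃
  rcases eq_or_eq_or_eq_of_trace_eq_of_det_eq h2 hdisc (ht₁.trans ht₂.symm) (ht₁.trans ht₃.symm)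
    (hd₁.trans hd₂.symm) (hd₁.trans hd₃.symm) with h | h | h
  · exact h₁₂ h
  · exact h₁₃ h
  · exact h₂₃ h

/-- The same bound for elements of `G` (through the injectivity of `mat`). [folklore] -/
lemma card_le_two_of_commute' (h2 : (2 : ZMod ℓ) ≠ 0) {X : Matrix (Fin 2) (Fin 2) (ZMod ℓ)}
    (hns : ∀ c : ZMod ℓ, X ≠ c • 1) (hdisc : X.trace ^ 2 - 4 * X.det ≠ 0) {τ δ : ZMod ℓ}
    (T : Finset G) (hT : ∀ g ∈ T, X * g.1.1 = g.1.1 * X ∧ (g.1.1).trace = τ ∧ (g.1.1).det = δ) :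
    T.card ≤ 2 := by
  classical
  rw [← Finset.card_image_of_injective T mat_injective']
  refine card_le_two_of_commute h2 hns hdisc (τ := τ) (δ := δ) (T.image fun g : G ↦ g.1.1) ?_
  simp only [Finset.mem_image, forall_exists_index, and_imp, forall_apply_eq_imp_iff₂]
  exact hT

/-- Non-central elements are non-scalar with non-zero discriminant when `ℓ ∤ |G|`, `ℓ` odd.
[folklore] -/
lemma nonscalar_of_not_mem_center (h2 : (2 : ZMod ℓ) ≠ 0) (hℓ : ¬ ℓ ∣ Nat.card G) {x : G}
    (hx : x ∉ Subgroup.center G) :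
    (∀ c : ZMod ℓ, x.1.1 ≠ c • 1) ∧ (x.1.1).trace ^ 2 - 4 * (x.1.1).det ≠ 0 := by
  have hns : ∀ c : ZMod ℓ, x.1.1 ≠ c • 1 := fun c hc ↦ hx (mem_center_of_mat_eq x hc)
  refine ⟨hns, disc_ne_zero_of_pow_eq_one h2 hns (det_mat_ne_zero x) (m := Nat.card G) ?_ ?_⟩
  · rwa [Ne, ZMod.natCast_eq_zero_iff]
  · rw [← mat_pow, pow_card_eq_one', mat_one]

/-- **Commutation is transitive off the centre** (`ℓ ∤ |G|` not even needed): for non-central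
`x, y ∈ G ⊆ GL₂(𝔽_ℓ)` with `xy = yx` one has `C_G(y) = C_G(x)` (both are `G ∩ 𝔽_ℓ[x]`).
[folklore] -/
lemma centralizer_eq_of_mem {x y : G} (hx : x ∉ Subgroup.center G) (hy : y ∉ Subgroup.center G)
    (hyx : y ∈ Subgroup.centralizer ({x} : Set G)) :
    Subgroup.centralizer ({y} : Set G) = Subgroup.centralizer {x} := by
  have hnsx : ∀ c : ZMod ℓ, x.1.1 ≠ c • 1 := fun c hc ↦ hx (mem_center_of_mat_eq x hc)
  have hc : x.1.1 * y.1.1 = y.1.1 * x.1.1 :=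
    ((commute_iff_mat x y).mp (Subgroup.mem_centralizer_singleton_iff.mp hyx)).symm
  obtain ⟨a, b, hab⟩ := exists_eq_smul_one_add_smul_of_commute hnsx hc
  have hb : b ≠ 0 := by
    rintro rfl
    rw [zero_smul, add_zero] at hab
    exact hy (mem_center_of_mat_eq y hab)
  obtain ⟨a', b', hab'⟩ := exists_eq_smul_one_add_smul_symm hab hb
  ext z
  rw [Subgroup.mem_centralizer_singleton_iff, Subgroup.mem_centralizer_singleton_iff,
    commute_iff_mat, commute_iff_mat]
  constructor
  · intro h
    exact (mul_eq_mul_of_eq_smul_one_add_smul hab' (h.symm)).symm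
  · intro h
    exact (mul_eq_mul_of_eq_smul_one_add_smul hab (h.symm)).symm

/-- Conjugation does not change trace and determinant. [folklore] -/
lemma trace_det_mat_conj (k x : G) :
    ((k * x * k⁻¹).1.1).trace = (x.1.1).trace ∧ ((k * x * k⁻¹).1.1).det = (x.1.1).det := by
  have hk : IsUnit (k.1.1).det := (det_mat_ne_zero k).isUnit
  rw [mat_mul, mat_mul, mat_inv]
  constructor
  · rw [Matrix.trace_mul_cycle, Matrix.nonsing_inv_mul _ hk, one_mul]
  · rw [Matrix.det_mul, Matrix.det_mul, Matrix.det_nonsing_inv, mul_right_comm,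
      Ring.mul_inverse_cancel _ hk, one_mul]

/-- **The normaliser of a maximal torus**: for non-central `x` (with `ℓ ∤ |G|`, `ℓ` odd),
`|N_G(C_G(x))| ≤ 2 |C_G(x)|` — the conjugates of `x` under the normaliser lie in
`C_G(x) ⊆ 𝔽_ℓ[x]` and share its trace and determinant, so there are at most two of them.
[folklore] -/
lemma card_normalizer_centralizer_le [Fintype G] (h2 : (2 : ZMod ℓ) ≠ 0)
    (hℓ : ¬ ℓ ∣ Nat.card G) {x : G}
    (hx : x ∉ Subgroup.center G) :
    Nat.card (Subgroup.normalizer (Subgroup.centralizer ({x} : Set G) : Set G)) ≤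
      2 * Nat.card (Subgroup.centralizer ({x} : Set G)) := by
  classical
  obtain ⟨hns, hdisc⟩ := nonscalar_of_not_mem_center h2 hℓ hx
  set C := Subgroup.centralizer ({x} : Set G) with hC
  set Nm := Subgroup.normalizer (C : Set G) with hNm
  let φ : Nm → Matrix (Fin 2) (Fin 2) (ZMod ℓ) := fun k ↦ ((k : G) * x * (k : G)⁻¹).1.1
  have hconj_mem : ∀ k : Nm, (k : G) * x * (k : G)⁻¹ ∈ C := fun k ↦
    (Subgroup.mem_normalizer_iff.mp k.2 x).mp (Subgroup.mem_centralizer_singleton_iff.mpr rfl)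
  -- fibres of `φ` are cosets of `C`
  have hfib : ∀ m ∈ (Finset.univ : Finset Nm).image φ,
      (Finset.univ.filter (fun k ↦ φ k = m)).card ≤ Nat.card C := by
    intro m hm
    obtain ⟨k₀, -, rfl⟩ := Finset.mem_image.mp hm
    let ψ : C → Nm := fun c ↦ ⟨(k₀ : G) * c, Nm.mul_mem k₀.2 (Subgroup.le_normalizer c.2)⟩
    have hsub : Finset.univ.filter (fun k ↦ φ k = φ k₀) ⊆ Finset.univ.image ψ := by
      intro k hk
      have hkk : (k : G) * x * (k : G)⁻¹ = k₀ * x * (k₀ : G)⁻¹ :=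
        mat_injective (Finset.mem_filter.mp hk).2
      have hc : (k₀ : G)⁻¹ * k ∈ C := by
        rw [hC, Subgroup.mem_centralizer_singleton_iff]
        calc (k₀ : G)⁻¹ * k * x = (k₀ : G)⁻¹ * ((k : G) * x * (k : G)⁻¹) * k := by
              simp only [mul_assoc, inv_mul_cancel, mul_one]
          _ = (k₀ : G)⁻¹ * (k₀ * x * (k₀ : G)⁻¹) * k := by rw [hkk]
          _ = x * ((k₀ : G)⁻¹ * k) := by simp only [mul_assoc, inv_mul_cancel_left]
      refine Finset.mem_image.mpr ⟨⟨_, hc⟩, Finset.mem_univ _, ?_⟩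
      exact Subtype.ext (mul_inv_cancel_left _ _)
    calc (Finset.univ.filter (fun k ↦ φ k = φ k₀)).card ≤ (Finset.univ.image ψ).card :=
          Finset.card_le_card hsub
      _ ≤ (Finset.univ : Finset C).card := Finset.card_image_le
      _ = Nat.card C := by rw [Finset.card_univ, Nat.card_eq_fintype_card]
  -- the image has at most two elements
  have himg : ((Finset.univ : Finset Nm).image φ).card ≤ 2 := by
    refine card_le_two_of_commute h2 hns hdisc (τ := (x.1.1).trace) (δ := (x.1.1).det) _ ?_
    intro m hm
    obtain ⟨k, -, rfl⟩ := Finset.mem_image.mp hm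
    have h1 := trace_det_mat_conj (k : G) x
    refine ⟨?_, h1.1, h1.2⟩
    exact ((commute_iff_mat x _).mp
      (Subgroup.mem_centralizer_singleton_iff.mp (hconj_mem k))).symm
  calc Nat.card Nm = (Finset.univ : Finset Nm).card := by
        rw [Finset.card_univ, Nat.card_eq_fintype_card]
    _ ≤ Nat.card C * ((Finset.univ : Finset Nm).image φ).card :=
        Finset.card_le_mul_card_image _ _ hfib
    _ ≤ Nat.card C * 2 := Nat.mul_le_mul_left _ himg
    _ = 2 * Nat.card C := mul_comm _ _

/-- In a non-abelian `G ⊆ GL₂(𝔽_ℓ)` the centre consists of scalars. [folklore] -/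
lemma exists_mat_eq_smul_one_of_mem_center (hna : ¬ ∀ a b : G, a * b = b * a) {z : G}
    (hz : z ∈ Subgroup.center G) : ∃ c : ZMod ℓ, z.1.1 = c • 1 := by
  by_contra hns
  push Not at hns
  apply hna
  intro a b
  have hcomm : ∀ y : G, z.1.1 * y.1.1 = y.1.1 * z.1.1 := fun y ↦
    ((commute_iff_mat z y).mp (Subgroup.mem_center_iff.mp hz y)).symm
  obtain ⟨α, β, hαβ⟩ := exists_eq_smul_one_add_smul_of_commute hns (hcomm a)
  rw [commute_iff_mat]
  exact (mul_eq_mul_of_eq_smul_one_add_smul hαβ (hcomm b))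

/-- **Fibre bound through the centre**: in a non-abelian `G ⊆ GL₂(𝔽_ℓ)`, at most
`2 [G : Z(G)]` elements have a given trace and determinant (`g ↦ g Z(G)` is at most
two-to-one on such elements, since a central element is a scalar `c` with `c² = 1`).
[cite: DeligneSerreASENS1974, proof of Prop. 7.2, cas (d)] -/
lemma card_filter_trace_det_le_index_center [Fintype G] (hna : ¬ ∀ a b : G, a * b = b * a)
    (τ δ : ZMod ℓ) :
    (Finset.univ.filter (fun g : G ↦ (g.1.1).trace = τ ∧ (g.1.1).det = δ)).card ≤
      2 * (Subgroup.center G).index := by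
  classical
  set S := Finset.univ.filter (fun g : G ↦ (g.1.1).trace = τ ∧ (g.1.1).det = δ) with hS
  have hmemS : ∀ {k : G}, k ∈ S ↔ (k.1.1).trace = τ ∧ (k.1.1).det = δ := by simp [hS]
  set f : G → G ⧸ Subgroup.center G := QuotientGroup.mk with hf
  -- two distinct elements of `S` in the same coset of the centre are opposite
  have hopp : ∀ s ∈ S, ∀ s' ∈ S, f s = f s' → s ≠ s' → s'.1.1 = -s.1.1 := by
    intro s hs s' hs' hss' hne
    obtain ⟨c, hc⟩ := exists_mat_eq_smul_one_of_mem_center hna (QuotientGroup.eq.mp hss')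
    have hs'c : s'.1.1 = c • s.1.1 := by
      rw [← mul_inv_cancel_left s s', mat_mul, hc, Matrix.mul_smul, mul_one]
    have hdet := congrArg Matrix.det hs'c
    rw [Matrix.det_smul, Fintype.card_fin, (hmemS.mp hs').2, (hmemS.mp hs).2] at hdet
    have hδ : δ ≠ 0 := (hmemS.mp hs).2 ▸ det_mat_ne_zero s
    have hc2 : c * c = 1 := by
      have : δ * (c ^ 2 - 1) = 0 := by linear_combination -hdet
      rcases mul_eq_zero.mp this with h | h
      · exact absurd h hδ
      · linear_combination h
    rcases mul_self_eq_one_iff.mp hc2 with rfl | rfl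
    · exact absurd (mat_injective (by rw [hs'c, one_smul])).symm hne
    · rw [hs'c, neg_one_smul]
  have hfib : ∀ q ∈ S.image f, (S.filter (fun s ↦ f s = q)).card ≤ 2 := by
    intro q hq
    by_contra hlt
    obtain ⟨s₁, hs₁, s₂, hs₂, s₃, hs₃, h₁₂, h₁₃, h₂₃⟩ := Finset.two_lt_card.mp (not_le.mp hlt)
    obtain ⟨hs₁, hq₁⟩ := Finset.mem_filter.mp hs₁
    obtain ⟨hs₂, hq₂⟩ := Finset.mem_filter.mp hs₂
    obtain ⟨hs₃, hq₃⟩ := Finset.mem_filter.mp hs₃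
    have e₂ := hopp s₁ hs₁ s₂ hs₂ (hq₁.trans hq₂.symm) h₁₂
    have e₃ := hopp s₁ hs₁ s₃ hs₃ (hq₁.trans hq₃.symm) h₁₃
    exact h₂₃ (mat_injective (e₂.trans e₃.symm))
  calc S.card ≤ 2 * (S.image f).card := Finset.card_le_mul_card_image _ _ hfib
    _ ≤ 2 * (Finset.univ : Finset (G ⧸ Subgroup.center G)).card :=
        Nat.mul_le_mul_left _ (Finset.card_le_univ _)
    _ = 2 * (Subgroup.center G).index := by
        rw [Finset.card_univ, Subgroup.index_eq_card, Nat.card_eq_fintype_card]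

/-- **Case (b) (`G` abelian)**: at most two elements per trace and determinant. [cite:
DeligneSerreASENS1974, proof of Prop. 7.2, cas (b)] -/
lemma card_filter_trace_det_le_two_of_comm [Fintype G] (h2 : (2 : ZMod ℓ) ≠ 0)
    (hℓ : ¬ ℓ ∣ Nat.card G)
    (hab : ∀ a b : G, a * b = b * a) (τ δ : ZMod ℓ) :
    (Finset.univ.filter (fun g : G ↦ (g.1.1).trace = τ ∧ (g.1.1).det = δ)).card ≤ 2 := by
  classical
  set S := Finset.univ.filter (fun g : G ↦ (g.1.1).trace = τ ∧ (g.1.1).det = δ) with hS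
  have hmemS : ∀ {k : G}, k ∈ S ↔ (k.1.1).trace = τ ∧ (k.1.1).det = δ := by simp [hS]
  by_cases hsc : ∀ x : G, ∃ c : ZMod ℓ, x.1.1 = c • 1
  · -- all elements scalar: at most one per trace
    refine (Finset.card_le_one.mpr ?_).trans one_le_two
    intro a ha b hb
    obtain ⟨c, hc⟩ := hsc a
    obtain ⟨c', hc'⟩ := hsc b
    have hta := (hmemS.mp ha).1
    have htb := (hmemS.mp hb).1
    rw [hc, Matrix.trace_smul, Matrix.trace_one, Fintype.card_fin] at hta
    rw [hc', Matrix.trace_smul, Matrix.trace_one, Fintype.card_fin] at htb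
    have hcc : c = c' := by
      have : (c - c') * 2 = 0 := by
        rw [smul_eq_mul] at hta htb
        push_cast at hta htb
        linear_combination hta - htb
      rcases mul_eq_zero.mp this with h | h
      · exact sub_eq_zero.mp h
      · exact absurd h h2
    exact mat_injective (by rw [hc, hc', hcc])
  · push Not at hsc
    obtain ⟨x, hx⟩ := hsc
    have hxZ : x ∉ Subgroup.center G ∨ x ∈ Subgroup.center G := em' _
    -- `x` is non-scalar; every element commutes with it
    have hdisc : (x.1.1).trace ^ 2 - 4 * (x.1.1).det ≠ 0 :=
      disc_ne_zero_of_pow_eq_one h2 hx (det_mat_ne_zero x) (m := Nat.card G)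
        (by rwa [Ne, ZMod.natCast_eq_zero_iff]) (by rw [← mat_pow, pow_card_eq_one', mat_one])
    refine card_le_two_of_commute' h2 hx hdisc S fun g hg ↦ ⟨?_, hmemS.mp hg⟩
    exact ((commute_iff_mat x g).mp (hab g x)).symm

end CasePrime

/-! ## Property C: reduction to fibre counts -/

section PropertyC

variable {G : Subgroup (GL (Fin 2) (ZMod ℓ))} [Fintype G]

/-- **Step 0.** Property `C(η, M)` yields at most `M` pairs `(τ, δ)` whose fibres in `G` carry
at least `(1 - η)|G|` elements. [cite: DeligneSerreASENS1974, §7.1] -/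
lemma exists_fibres_of_hasPropertyC {η : ℝ} {M : ℕ} (hC : HasPropertyC G η M) :
    ∃ F : Finset (ZMod ℓ × ZMod ℓ), F.card ≤ M ∧
      (1 - η) * (Nat.card G : ℝ) ≤ ∑ q ∈ F,
        ((Finset.univ.filter (fun g : G ↦ (g.1.1).trace = q.1 ∧ (g.1.1).det = q.2)).card : ℝ) := by
  classical
  obtain ⟨H, hHG, hcard, hpoly⟩ := hC
  set H' : Finset G := H.subtype (· ∈ G) with hH'
  have hH'card : H'.card = H.card := by
    rw [hH', Finset.card_subtype]
    congr 1
    exact Finset.filter_true_of_mem fun h hh ↦ hHG hh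
  let td : G → ZMod ℓ × ZMod ℓ := fun g ↦ ((g.1.1).trace, (g.1.1).det)
  let ψ : Polynomial (ZMod ℓ) → ZMod ℓ × ZMod ℓ := fun p ↦ (-p.coeff 1, p.coeff 2)
  have htd : td = ψ ∘ (fun g : G ↦ (g.1.1).charpolyRev) := by
    funext g
    simp only [Function.comp_apply, td, ψ, charpolyRev_fin_two, Polynomial.coeff_add,
      Polynomial.coeff_sub, Polynomial.coeff_one, Polynomial.coeff_C_mul_X,
      Polynomial.coeff_C_mul_X_pow]
    norm_num
  set F := H'.image td with hF
  refine ⟨F, ?_, ?_⟩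
  · -- `|F| ≤ #{charpolyRev h : h ∈ H} ≤ M`
    have h1 : F = (H'.image (fun g : G ↦ (g.1.1).charpolyRev)).image ψ := by
      rw [hF, Finset.image_image, htd]
    have h2 : H'.image (fun g : G ↦ (g.1.1).charpolyRev) =
        H.image (fun h : GL (Fin 2) (ZMod ℓ) ↦
          (h : Matrix (Fin 2) (Fin 2) (ZMod ℓ)).charpolyRev) := by
      ext p
      simp only [Finset.mem_image, hH', Finset.mem_subtype]
      constructor
      · rintro ⟨g, hg, rfl⟩; exact ⟨g, hg, rfl⟩
      · rintro ⟨h, hh, rfl⟩; exact ⟨⟨h, hHG hh⟩, hh, rfl⟩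
    calc F.card ≤ (H'.image (fun g : G ↦ (g.1.1).charpolyRev)).card := by
          rw [h1]; exact Finset.card_image_le
      _ = ((fun h : GL (Fin 2) (ZMod ℓ) ↦
            (h : Matrix (Fin 2) (Fin 2) (ZMod ℓ)).charpolyRev) '' (H : Set _)).ncard := by
          rw [h2, ← Finset.coe_image, Set.ncard_coe_finset]
      _ ≤ M := hpoly
  · calc (1 - η) * (Nat.card G : ℝ) ≤ H.card := hcard
      _ = H'.card := by rw [hH'card]
      _ = ∑ q ∈ F, ((H'.filter (fun g ↦ td g = q)).card : ℝ) := by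
          rw [Finset.card_eq_sum_card_fiberwise (fun g hg ↦ Finset.mem_image_of_mem td hg)]
          push_cast
          rfl
      _ ≤ _ := by
          gcongr with q hq
          intro g hg
          obtain ⟨-, hgq⟩ := Finset.mem_filter.mp hg
          simp only [Finset.mem_filter, Finset.mem_univ, true_and]
          exact ⟨congrArg Prod.fst hgq, congrArg Prod.snd hgq⟩

end PropertyC

/-! ## Assembly: proof of Prop. 7.2 -/

section Assembly

/-- `|G| ≤ |GL₂(𝔽_ℓ)| ≤ ℓ⁴`. [folklore] -/
lemma card_subgroup_le_pow_four (G : Subgroup (GL (Fin 2) (ZMod ℓ))) : Nat.card G ≤ ℓ ^ 4 := by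
  calc Nat.card G ≤ Nat.card (GL (Fin 2) (ZMod ℓ)) := Subgroup.card_le_card_group G
    _ ≤ Nat.card (Matrix (Fin 2) (Fin 2) (ZMod ℓ)) :=
        Nat.card_le_card_of_injective _ Units.val_injective
    _ = ℓ ^ 4 := by
        rw [show Nat.card (Matrix (Fin 2) (Fin 2) (ZMod ℓ)) = Nat.card (Fin 2 → Fin 2 → ZMod ℓ)
          from rfl, Nat.card_fun, Nat.card_fun, Nat.card_zmod, Nat.card_eq_fintype_card,
          Fintype.card_fin]
        ring

/-- `2 ≠ 0` in `𝔽_ℓ` for an odd prime `ℓ`. [folklore] -/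
lemma two_ne_zero_of_ne_two (hℓ2 : ℓ ≠ 2) : (2 : ZMod ℓ) ≠ 0 := by
  intro h
  have h' : ((2 : ℕ) : ZMod ℓ) = 0 := by exact_mod_cast h
  rw [ZMod.natCast_eq_zero_iff] at h'
  rcases Nat.prime_two.eq_one_or_self_of_dvd ℓ h' with h1 | h2
  · exact (Fact.out : ℓ.Prime).one_lt.ne' h1
  · exact hℓ2 h2

/-- A natural number bounded in `ℝ` by `c / d` (`d > 0`) through `n d ≤ c` is at most
`⌊c / d⌋₊`. [folklore] -/
lemma nat_le_floor_div {n : ℕ} {c d : ℝ} (hd : 0 < d) (h : (n : ℝ) * d ≤ c) : n ≤ ⌊c / d⌋₊ := by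
  apply Nat.le_floor
  rwa [le_div_iff₀ hd]

/-- **Deligne–Serre 1974, Prop. 7.2**, discharged: for `0 ≤ η < 1/2` and `M` there is
`A = A(η, M)` bounding the order of every semisimple subgroup `G ⊆ GL₂(𝔽_ℓ)` (`ℓ` prime) with
property `C(η, M)`. We take `A = 16 + b₁⁴ + b₁ + b₂ + b₃` with `b₁ = ⌊2M/(1-η)⌋`,
`b₂ = ⌊4M/(1-2η)⌋`, `b₃ = ⌊120M/(1-η)⌋`, covering respectively `ℓ = 2`, case (a) `ℓ ∣ |G|`
(`ℓ ≤ b₁`, `|G| ≤ ℓ⁴`), case (b) `G` abelian, case (c) a maximal torus of index `2`, and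
case (d) `[G : Z(G)] ≤ 60`; the case distinction for `ℓ ∤ |G|` is the counting lemma
`Counting.card_le_sixty_mul_card_center` in place of Dickson's list.
[cite: DeligneSerreASENS1974, Prop. 7.2] -/
theorem prop72_holds : prop72 := by
  intro η M hη0 hη
  set b₁ : ℕ := ⌊2 * M / (1 - η)⌋₊ with hb₁
  set b₂ : ℕ := ⌊4 * M / (1 - 2 * η)⌋₊ with hb₂
  set b₃ : ℕ := ⌊120 * M / (1 - η)⌋₊ with hb₃
  refine ⟨16 + b₁ ^ 4 + b₁ + b₂ + b₃, ?_⟩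
  intro ℓ _ G hss hC
  classical
  haveI : Fintype G := Fintype.ofFinite G
  have hℓp : ℓ.Prime := Fact.out
  have h1η : 0 < 1 - η := by linarith
  have h12η : 0 < 1 - 2 * η := by linarith
  have hGpos : 0 < Nat.card G := Nat.card_pos
  have hGposR : (0 : ℝ) < Nat.card G := by exact_mod_cast hGpos
  have hG4 : Nat.card G ≤ ℓ ^ 4 := card_subgroup_le_pow_four G
  obtain ⟨F, hFM, hFsum⟩ := exists_fibres_of_hasPropertyC hC
  have hFMR : (F.card : ℝ) ≤ M := by exact_mod_cast hFM
  set S : ZMod ℓ × ZMod ℓ → Finset G := fun q ↦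
    Finset.univ.filter (fun g : G ↦ (g.1.1).trace = q.1 ∧ (g.1.1).det = q.2) with hSdef
  have hFsum' : (1 - η) * (Nat.card G : ℝ) ≤ ∑ q ∈ F, ((S q).card : ℝ) := hFsum
  -- from a uniform fibre bound `|S q| ≤ B` we get `|G| (1 - η) ≤ B M`
  have fibre_bound : ∀ B : ℕ, (∀ q ∈ F, (S q).card ≤ B) →
      (Nat.card G : ℝ) * (1 - η) ≤ B * M := by
    intro B hB
    calc (Nat.card G : ℝ) * (1 - η) = (1 - η) * Nat.card G := mul_comm _ _
      _ ≤ ∑ q ∈ F, ((S q).card : ℝ) := hFsum'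
      _ ≤ ∑ q ∈ F, (B : ℝ) := Finset.sum_le_sum fun q hq ↦ by exact_mod_cast hB q hq
      _ = F.card * B := by rw [Finset.sum_const, nsmul_eq_mul]
      _ ≤ M * B := by gcongr
      _ = B * M := mul_comm _ _
  -- `ℓ = 2`
  by_cases hℓ2 : ℓ = 2
  · subst hℓ2
    have : Nat.card G ≤ 16 := by simpa using hG4
    omega
  have h2 : (2 : ZMod ℓ) ≠ 0 := two_ne_zero_of_ne_two hℓ2
  by_cases hdvd : ℓ ∣ Nat.card G
  · -- case (a): `ℓ (1 - η) ≤ 2M`, `|G| ≤ ℓ⁴`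
    have key : ∀ q ∈ F, (ℓ : ℝ) * ((S q).card : ℝ) ≤ 2 * (Nat.card G : ℝ) := by
      intro q _
      have := mul_card_filter_trace_det_le_of_dvd hss hdvd q.1 q.2
      exact_mod_cast this
    have hℓη : (ℓ : ℝ) * (1 - η) ≤ 2 * M := by
      have : (ℓ : ℝ) * (1 - η) * Nat.card G ≤ 2 * M * Nat.card G := by
        calc (ℓ : ℝ) * (1 - η) * Nat.card G = ℓ * ((1 - η) * Nat.card G) := by ring
          _ ≤ ℓ * ∑ q ∈ F, ((S q).card : ℝ) := by gcongr
          _ = ∑ q ∈ F, (ℓ : ℝ) * ((S q).card : ℝ) := by rw [Finset.mul_sum]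
          _ ≤ ∑ q ∈ F, (2 * (Nat.card G : ℝ)) := Finset.sum_le_sum key
          _ = F.card * (2 * Nat.card G) := by rw [Finset.sum_const, nsmul_eq_mul]
          _ ≤ M * (2 * Nat.card G) := by gcongr
          _ = 2 * M * Nat.card G := by ring
      exact le_of_mul_le_mul_right this hGposR
    have hℓb : ℓ ≤ b₁ := nat_le_floor_div h1η hℓη
    calc Nat.card G ≤ ℓ ^ 4 := hG4
      _ ≤ b₁ ^ 4 := Nat.pow_le_pow_left hℓb 4
      _ ≤ _ := by omega
  by_cases hab : ∀ a b : G, a * b = b * a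
  · -- case (b): `G` abelian
    have hb := fibre_bound 2 fun q _ ↦ card_filter_trace_det_le_two_of_comm h2 hdvd hab q.1 q.2
    have hGb : Nat.card G ≤ b₁ := nat_le_floor_div h1η (by push_cast at hb; linarith)
    omega
  by_cases h3 : ∀ x : G, x ∉ Subgroup.center G →
      3 * Nat.card (Subgroup.centralizer ({x} : Set G)) ≤ Nat.card G
  · -- case (d): `[G : Z(G)] ≤ 60`
    have h60 := Counting.card_le_sixty_mul_card_center (G := G)
      (fun x y hx hy hyx ↦ centralizer_eq_of_mem hx hy hyx)
      (fun x hx ↦ card_normalizer_centralizer_le h2 hdvd hx) h3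
    have hidx : (Subgroup.center G).index ≤ 60 := by
      have hmul := (Subgroup.center G).index_mul_card
      have hZpos : 0 < Nat.card (Subgroup.center G) := Nat.card_pos
      rw [← hmul] at h60
      exact Nat.le_of_mul_le_mul_right h60 hZpos
    have hb := fibre_bound 120 fun q _ ↦
      (card_filter_trace_det_le_index_center hab q.1 q.2).trans (by omega)
    have hGb : Nat.card G ≤ b₃ := nat_le_floor_div h1η (by push_cast at hb; linarith)
    omega
  · -- case (c): a maximal torus `A = C(x)` of index `≤ 2`
    push Not at h3
    obtain ⟨x, hx, h3x⟩ := h3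
    set A := Subgroup.centralizer ({x} : Set G) with hA
    have hAG : Nat.card G ≤ 2 * Nat.card A := by
      have hidx := A.index_mul_card
      have hlt : A.index < 3 := by
        by_contra hge
        push Not at hge
        have : 3 * Nat.card A ≤ A.index * Nat.card A := Nat.mul_le_mul_right _ hge
        omega
      calc Nat.card G = A.index * Nat.card A := hidx.symm
        _ ≤ 2 * Nat.card A := Nat.mul_le_mul_right _ (by omega)
    have hAleG : Nat.card A ≤ Nat.card G := Subgroup.card_le_card_group A
    obtain ⟨hns, hdisc⟩ := nonscalar_of_not_mem_center h2 hdvd hx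
    -- inside `A`: at most two elements per fibre
    have hSA : ∀ q ∈ F, ((S q).filter (· ∈ A)).card ≤ 2 := by
      intro q _
      refine card_le_two_of_commute' h2 hns hdisc (τ := q.1) (δ := q.2) _ ?_
      intro g hg
      obtain ⟨hgS, hgA⟩ := Finset.mem_filter.mp hg
      obtain ⟨-, hgq⟩ := Finset.mem_filter.mp hgS
      exact ⟨((commute_iff_mat x g).mp (Subgroup.mem_centralizer_singleton_iff.mp hgA)).symm,
        hgq⟩
    -- outside `A`: the fibres are disjoint subsets of `G ∖ A`
    have hSout : ∑ q ∈ F, ((S q).filter (· ∉ A)).card ≤ Nat.card G - Nat.card A := by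
      have hdisj : (F : Set (ZMod ℓ × ZMod ℓ)).PairwiseDisjoint
          (fun q ↦ (S q).filter (· ∉ A)) := by
        intro q _ q' _ hne
        rw [Function.onFun, Finset.disjoint_left]
        intro g hg hg'
        obtain ⟨hgS, -⟩ := Finset.mem_filter.mp hg
        obtain ⟨hgS', -⟩ := Finset.mem_filter.mp hg'
        obtain ⟨-, h1, h1'⟩ := Finset.mem_filter.mp hgS
        obtain ⟨-, h2, h2'⟩ := Finset.mem_filter.mp hgS'
        exact hne (Prod.ext (h1.symm.trans h2) (h1'.symm.trans h2'))
      rw [← Finset.card_biUnion hdisj]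
      have hsub : F.biUnion (fun q ↦ (S q).filter (· ∉ A)) ⊆ Finset.univ.filter (· ∉ A) := by
        intro g hg
        simp only [Finset.mem_biUnion, Finset.mem_filter, Finset.mem_univ, true_and] at hg ⊢
        obtain ⟨q, -, -, hgA⟩ := hg
        exact hgA
      refine (Finset.card_le_card hsub).trans ?_
      have hAc : (Finset.univ.filter (· ∈ A)).card = Nat.card A := by
        rw [Nat.card_eq_fintype_card, ← Fintype.card_subtype]
      have := Finset.card_filter_add_card_filter_not (s := Finset.univ) (fun g : G ↦ g ∈ A)
      rw [hAc, Finset.card_univ, ← Nat.card_eq_fintype_card] at this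
      omega
    have hsplit : ∑ q ∈ F, (S q).card =
        ∑ q ∈ F, ((S q).filter (· ∈ A)).card + ∑ q ∈ F, ((S q).filter (· ∉ A)).card := by
      rw [← Finset.sum_add_distrib]
      exact Finset.sum_congr rfl fun q _ ↦ (Finset.card_filter_add_card_filter_not _).symm
    have hin : ∑ q ∈ F, ((S q).filter (· ∈ A)).card ≤ 2 * M :=
      calc ∑ q ∈ F, ((S q).filter (· ∈ A)).card ≤ ∑ q ∈ F, 2 := Finset.sum_le_sum hSA
        _ = F.card * 2 := by rw [Finset.sum_const, smul_eq_mul]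
        _ ≤ M * 2 := Nat.mul_le_mul_right _ hFM
        _ = 2 * M := mul_comm _ _
    have htot : ∑ q ∈ F, (S q).card + Nat.card A ≤ 2 * M + Nat.card G := by omega
    have htotR : (1 - η) * (Nat.card G : ℝ) + Nat.card A ≤ 2 * M + Nat.card G := by
      have h1 : (((∑ q ∈ F, (S q).card + Nat.card A : ℕ)) : ℝ) ≤
          ((2 * M + Nat.card G : ℕ) : ℝ) := by
        exact_mod_cast htot
      push_cast at h1
      linarith
    -- `|A| (1 - 2η) ≤ 2M` and `|G| ≤ 2|A|`
    have hAGR : (Nat.card G : ℝ) ≤ 2 * Nat.card A := by exact_mod_cast hAG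
    have hA2 : (Nat.card A : ℝ) * (1 - 2 * η) ≤ 2 * M := by nlinarith
    have hGb : Nat.card G ≤ b₂ := nat_le_floor_div h12η (by nlinarith)
    omega

end Assembly

end Literature.NumberTheory.GaloisRepresentations.DeligneSerre1974
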